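import Literature.Barriers.CriticalPhenomena.SAPSectionParity
import Mathlib.Combinatorics.Enumerative.DoubleCounting
import HarnessLib

/-!
# Counting the sections of a section-minimal polygon: Rechnitzer's Theorem 12 proved
# (haruspicy, layer 8)

Companion of `SAPSectionLines` / `SAPSectionParity` (A. Rechnitzer, *Haruspicy 2*, J. Combin.
Theory Ser. A 113 (2006) 520–546; arXiv:math/0406450v2, §2.2). `SAPSectionLines` defines the
sections of a polygon word and vendors **Theorem 12** — "A section-minimal polygon `P` that
contains `2V = (6k-4+2M)` vertical bonds may not contain more than `2M+1` sections that contain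
`2k` or more horizontal bonds" — as the named fact `Rechnitzer2006_thm12`. This file DISCHARGES
it: `Rechnitzer2006_thm12_holds`.

## The proof

The printed proof bounds the number of sections of a section-minimal polygon by `2V-1`
(Lemmas 7–9, counting pages and the vertical bonds inside them) and then STRETCHES the polygon
(Lemma 11, a construction) to exhibit `3(k-1)` sections that are not `k`-sections beyond each
outermost `k`-section, whence `#(k-sections) ≤ 2V-1-6(k-1) = 2M+1`. We prove the same bound by
one direct count which needs no new polygon. It rests on the printed mechanism of Lemmas 5 and 7
("between any two sections in this page there must be at least 1 vertical bond (otherwise the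
horizontal bonds in both sections would be the same and they would be duplicate sections)",
here `IsCanon.isDup_of_noBond`) and on the crossing parity of `SAPSectionParity` (the "inside" /
"outside" of Lemma 10).

* **Part 1, the census of runs** (`Haruspicy.Census`, abstract). Data: finitely many rows `j`,
  each with the columns `L j < R j` of its leftmost and rightmost vertical bonds; the bonds as
  pairs `(column, row)`; and sections recorded as pairs `(gap, bottom row of the run)` — a row
  `j` being *active* at the gap `g` when `L j ≤ g < R j` (no section line of that row crosses the
  gap), a *run* at `g` a maximal interval `[a, b-1]` of active rows. Hypothesis
  (`Census.Valid.sm`): two recorded sections with the same bottom row at gaps `c < c'`, all gaps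
  of `[c, c']` having the same run `[a, b-1]`, are separated by a bond in a column of `(c, c']`
  and a row of `[a, b-1]`. **Census inequality** (`Census.card_secs_le_card`): if all recorded
  sections lie at gaps in `[gL, gR]`, they are at most as many as the bonds NOT of four kinds —
  inner bonds (`L j < column < R j`) in columns `≤ gL` or `> gR`; leftmost bonds of rows `j` with
  `j, j-1` active at `gL`; rightmost bonds of rows `j` with `j, j-1` active at `gR`; rightmost
  bonds of rows `j` with `j-1` not a row. Proof: charge each section to the leftmost or rightmost
  bond of its bottom row when it is the first of its *group* (the sections with that bottom row
  at a maximal interval of gaps where runs start at that row), and otherwise to a bond in a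
  column between it and its predecessor in the group: a rightmost/leftmost bond where the common
  run first shrinks/grows, or the inner bond of `Valid.sm` when it never changes
  (`Census.exists_rel`); distinct sections are charged to distinct bonds (`Census.rel_subsingleton`).
* **Part 2, the census of a polygon word.** Rows, extreme columns `Lw`, `Rw` (`Lw < Rw` by row
  parity and vertical edge simplicity, `IsSAP.Lw_lt_Rw`), `ActiveW ↔ ¬ Crosses`
  (`activeW_iff_not_crosses`); horizontal bonds pass straight through a vertex without vertical
  bonds (`IsCanon.mem_gapHeights_sub_one_iff`), whence a bond-free column inside a page
  duplicates a section (`IsCanon.isDup_of_noBond`) and the census of a section-minimal canonical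
  word is valid (`censusW_valid`). Each section with `≥ 2k ≥ 2` heights is recorded by its bottom
  row, injectively (`card_bigSecs_le_card_secPairs`). Between the outermost gaps `gL ≤ gR` of the
  big sections at least `6k-5` bonds are of the four unused kinds (`card_unused_ge`): `k-1` inner
  bonds left of `gL` and `k-1` right of `gR` on the rows of even rank of the two outermost big
  sections (both sides carry an even positive number of vertical letters there,
  `IsSAP.two_le_card_vLeft_vRight`, as in Lemma 10), `2k-2` leftmost and `2k-2` rightmost bonds
  of their inner rows, and the rightmost bond of the lowest row. With at most `vcount w =
  6k-4+2M` bonds: `#big ≤ (6k-4+2M) - (6k-5) = 2M+1` (`Rechnitzer2006_thm12_holds`).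

What is NOT here: pages as planar regions, the stretching construction of Lemma 11 and the bound
`2V-1` on all sections (Lemma 9) as separate statements (the case `k = 1` of the count gives it for
the sections with at least two heights).

## References

* A. Rechnitzer, *Haruspicy 2*, J. Combin. Theory Ser. A 113 (2006) 520–546, §2.1 (Lemma 5),
  §2.2 (Lemmas 7–11, Theorem 12). [Rechnitzer2006Haruspicy2]
-/

noncomputable section

open Finset

namespace Literature.Barriers.CriticalPhenomena

namespace Haruspicy

/-! ### The abstract census of rows, bonds and sections -/

/-- The data of a census: rows with their extreme bond columns, bonds `(column, row)`, and
sections recorded as `(gap, bottom row of the run)`. [folklore] -/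
structure Census where
  /-- the rows carrying vertical bonds -/
  rows : Finset ℤ
  /-- column of the leftmost vertical bond of a row -/
  L : ℤ → ℤ
  /-- column of the rightmost vertical bond of a row -/
  R : ℤ → ℤ
  /-- the vertical bonds, as pairs `(column, row)` -/
  bonds : Finset (ℤ × ℤ)
  /-- the recorded sections, as pairs `(gap, bottom row of the run)` -/
  secs : Finset (ℤ × ℤ)

namespace Census

variable (C : Census)

/-- Row `j` is **active** at the gap `g`: it is a row and `L j ≤ g < R j` (no section line of
that row crosses the gap). [folklore] -/
def Active (g j : ℤ) : Prop := j ∈ C.rows ∧ C.L j ≤ g ∧ g < C.R j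

/-- A run of active rows **starts** at row `a` at the gap `g`. [folklore] -/
def Starts (g a : ℤ) : Prop := C.Active g a ∧ ¬ C.Active g (a - 1)

/-- `[a, b-1]` is a **run** (maximal interval of active rows) at the gap `g`. [folklore] -/
def IsRun (g a b : ℤ) : Prop :=
  a < b ∧ (∀ j, a ≤ j → j < b → C.Active g j) ∧ ¬ C.Active g (a - 1) ∧ ¬ C.Active g b

/-- All gaps of `[c₁, c₂]` have a run starting at row `a` (the sections there with bottom row `a`
form one **group**). [folklore] -/
def InGroup (a c₁ c₂ : ℤ) : Prop := ∀ g, c₁ ≤ g → g ≤ c₂ → C.Starts g a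

/-- `c⁻` is the **predecessor** of the recorded section `(c, a)`: the largest gap `< c` of a
recorded section with bottom row `a` in the same group. [folklore] -/
def IsPred (c a cp : ℤ) : Prop :=
  (cp, a) ∈ C.secs ∧ cp < c ∧ C.InGroup a cp c ∧
    ∀ c'', (c'', a) ∈ C.secs → c'' < c → C.InGroup a c'' c → c'' ≤ cp

/-- The recorded section `(c, a)` is the first of its group. [folklore] -/
def NoPred (c a : ℤ) : Prop := ∀ c'', (c'', a) ∈ C.secs → c'' < c → ¬ C.InGroup a c'' c

/-- The hypotheses of the census: `L < R` on rows, the extreme bonds are bonds, bonds lie on rows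
between the extremes, recorded sections start runs, and **section-minimality**: two recorded
sections of one group at gaps `c < c'` with equal runs throughout `[c, c']` are separated by a
bond in a column of `(c, c']` and a row of the run. [folklore] -/
structure Valid : Prop where
  lt : ∀ j ∈ C.rows, C.L j < C.R j
  memL : ∀ j ∈ C.rows, (C.L j, j) ∈ C.bonds
  memR : ∀ j ∈ C.rows, (C.R j, j) ∈ C.bonds
  bond : ∀ p ∈ C.bonds, p.2 ∈ C.rows ∧ C.L p.2 ≤ p.1 ∧ p.1 ≤ C.R p.2
  starts : ∀ s ∈ C.secs, C.Starts s.1 s.2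
  sm : ∀ a b c c', (c, a) ∈ C.secs → (c', a) ∈ C.secs → c < c' →
    (∀ g, c ≤ g → g ≤ c' → C.IsRun g a b) →
      ∃ p ∈ C.bonds, c < p.1 ∧ p.1 ≤ c' ∧ a ≤ p.2 ∧ p.2 < b

/-- The bonds NOT charged by the count between the gaps `gL ≤ gR`: inner bonds in columns `≤ gL`
or `> gR`, leftmost bonds of rows `j` with `j, j-1` active at `gL`, rightmost bonds of rows `j`
with `j, j-1` active at `gR`, rightmost bonds of bottom rows. [folklore] -/
def Unused (gL gR : ℤ) (p : ℤ × ℤ) : Prop :=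
  (C.L p.2 < p.1 ∧ p.1 < C.R p.2 ∧ (p.1 ≤ gL ∨ gR < p.1)) ∨
  (p.1 = C.L p.2 ∧ C.Active gL p.2 ∧ C.Active gL (p.2 - 1)) ∨
  (p.1 = C.R p.2 ∧ C.Active gR p.2 ∧ C.Active gR (p.2 - 1)) ∨
  (p.1 = C.R p.2 ∧ p.2 - 1 ∉ C.rows)

/-- **The charging relation**: the recorded section `(c, a)` is charged to the bond `p` — the
leftmost or rightmost bond of row `a` if the section is the first of its group, and otherwise a
leftmost, rightmost or inner bond in a column of `(c⁻, c]` separating it from its predecessor.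
[folklore] -/
def Rel (c a : ℤ) (p : ℤ × ℤ) : Prop :=
  (C.NoPred c a ∧ p = (C.L a, a) ∧ C.InGroup a (C.L a) c) ∨
  (C.NoPred c a ∧ p = (C.R a, a) ∧ ¬ C.InGroup a (C.L a) c) ∨
  (∃ cp, C.IsPred c a cp ∧ cp < p.1 ∧ p.1 ≤ c ∧
    ((p.1 = C.L p.2 ∧ C.IsRun (p.1 - 1) a p.2 ∧ C.Active p.1 (p.2 - 1) ∧ C.Active p.1 p.2) ∨
     (p.1 = C.R p.2 ∧ (∃ b, C.IsRun (p.1 - 1) a b ∧ a < p.2 ∧ p.2 < b) ∧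
        C.Active p.1 (p.2 - 1)) ∨
     (C.L p.2 < p.1 ∧ p.1 < C.R p.2 ∧ (∃ b, C.IsRun p.1 a b ∧ a ≤ p.2 ∧ p.2 < b) ∧
        p ∈ C.bonds)))

variable {C}

/-! ### Runs -/

/-- An active row is a row. [folklore] -/
theorem Active.mem {g j : ℤ} (h : C.Active g j) : j ∈ C.rows := h.1

/-- Every starting row starts a run (the rows being finitely many). [folklore] -/
theorem exists_isRun {g a : ℤ} (hs : C.Starts g a) : ∃ b, C.IsRun g a b := by
  classical
  have hex : ∃ n : ℕ, ¬ C.Active g (a + 1 + n) := by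
    by_cases hne : C.rows.Nonempty
    · refine ⟨(C.rows.max' hne - a).toNat, fun h => ?_⟩
      have := C.rows.le_max' _ h.1
      omega
    · exact ⟨0, fun h => hne ⟨_, h.1⟩⟩
  refine ⟨a + 1 + Nat.find hex, by omega, fun j hj1 hj2 => ?_, hs.2, Nat.find_spec hex⟩
  rcases eq_or_lt_of_le hj1 with rfl | hlt
  · exact hs.1
  · obtain ⟨m, rfl⟩ : ∃ m : ℕ, j = a + 1 + m := ⟨(j - a - 1).toNat, by omega⟩
    have hm : m < Nat.find hex := by omega
    have := Nat.find_min hex hm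
    tauto

/-- A run starts at its bottom row. [folklore] -/
theorem IsRun.starts {g a b : ℤ} (h : C.IsRun g a b) : C.Starts g a :=
  ⟨h.2.1 a le_rfl h.1, h.2.2.1⟩

/-- **Overlapping runs of one gap coincide.** [folklore] -/
theorem IsRun.eq_of_mem {g a b a' b' j : ℤ} (h : C.IsRun g a b) (h' : C.IsRun g a' b')
    (hj : a ≤ j ∧ j < b) (hj' : a' ≤ j ∧ j < b') : a = a' ∧ b = b' := by
  obtain ⟨-, hact, hbot, htop⟩ := h
  obtain ⟨-, hact', hbot', htop'⟩ := h'
  constructor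
  · by_contra hne
    rcases lt_or_gt_of_ne hne with hlt | hlt
    · exact hbot' (hact (a' - 1) (by omega) (by omega))
    · exact hbot (hact' (a - 1) (by omega) (by omega))
  · by_contra hne
    rcases lt_or_gt_of_ne hne with hlt | hlt
    · exact htop (hact' b (by omega) (by omega))
    · exact htop' (hact b' (by omega) (by omega))

/-- The top of the run starting at a given row is unique. [folklore] -/
theorem IsRun.top_unique {g a b b' : ℤ} (h : C.IsRun g a b) (h' : C.IsRun g a b') : b = b' :=
  (h.eq_of_mem h' ⟨le_rfl, h.1⟩ ⟨le_rfl, h'.1⟩).2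

/-- A row inactive at `g-1` and active at `g` has its leftmost bond in column `g`. [folklore] -/
theorem L_eq_of_not_active_of_active (hV : C.Valid) {g m : ℤ} (h1 : ¬ C.Active (g - 1) m)
    (h2 : C.Active g m) : C.L m = g := by
  have hlt := hV.lt m h2.1
  have : ¬ (C.L m ≤ g - 1 ∧ g - 1 < C.R m) := fun h => h1 ⟨h2.1, h⟩
  unfold Active at h2
  omega

/-- A row active at `g-1` and inactive at `g` has its rightmost bond in column `g`. [folklore] -/
theorem R_eq_of_active_of_not_active (hV : C.Valid) {g m : ℤ} (h1 : C.Active (g - 1) m)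
    (h2 : ¬ C.Active g m) : C.R m = g := by
  have hlt := hV.lt m h1.1
  have : ¬ (C.L m ≤ g ∧ g < C.R m) := fun h => h2 ⟨h1.1, h⟩
  unfold Active at h1
  omega

/-! ### Groups and predecessors -/

/-- Sub-intervals of a group are in the group. [folklore] -/
theorem InGroup.mono {a c₁ c₂ d₁ d₂ : ℤ} (h : C.InGroup a c₁ c₂) (h1 : c₁ ≤ d₁) (h2 : d₂ ≤ c₂) :
    C.InGroup a d₁ d₂ := fun g hg1 hg2 => h g (by omega) (by omega)

/-- Every recorded section is the first of its group or has a predecessor. [folklore] -/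
theorem noPred_or_exists_isPred (c a : ℤ) : C.NoPred c a ∨ ∃ cp, C.IsPred c a cp := by
  classical
  by_cases h : ∃ c'', (c'', a) ∈ C.secs ∧ c'' < c ∧ C.InGroup a c'' c
  · right
    obtain ⟨c₀, h1, h2, h3⟩ := h
    obtain ⟨cp, hcp, hmax⟩ := Finset.exists_max_image
      ((C.secs.image Prod.fst).filter fun c'' => (c'', a) ∈ C.secs ∧ c'' < c ∧ C.InGroup a c'' c)
      id ⟨c₀, Finset.mem_filter.2 ⟨Finset.mem_image.2 ⟨(c₀, a), h1, rfl⟩, h1, h2, h3⟩⟩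
    rw [Finset.mem_filter] at hcp
    refine ⟨cp, hcp.2.1, hcp.2.2.1, hcp.2.2.2, fun c'' g1 g2 g3 => ?_⟩
    exact hmax c'' (Finset.mem_filter.2 ⟨Finset.mem_image.2 ⟨(c'', a), g1, rfl⟩, g1, g2, g3⟩)
  · left
    intro c'' h1 h2 h3
    exact h ⟨c'', h1, h2, h3⟩

/-- **If the first section of a group is not reached from `L a`, the row below ends first**:
`a-1` is a row with `R (a-1) ≤ c`. [folklore] -/
theorem notInGroup_L {c a : ℤ} (hst : C.Starts c a) (hng : ¬ C.InGroup a (C.L a) c) :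
    a - 1 ∈ C.rows ∧ C.R (a - 1) ≤ c := by
  classical
  unfold InGroup at hng
  push Not at hng
  obtain ⟨g, hg1, hg2, hns⟩ := hng
  have hact : C.Active g a := ⟨hst.1.1, hg1, lt_of_le_of_lt hg2 hst.1.2.2⟩
  have hbelow : C.Active g (a - 1) := by
    by_contra hna
    exact hns ⟨hact, hna⟩
  have hnc : ¬ (C.L (a - 1) ≤ c ∧ c < C.R (a - 1)) := fun h => hst.2 ⟨hbelow.1, h⟩
  refine ⟨hbelow.1, ?_⟩
  unfold Active at hbelow
  omega

/-- In that case the rest of `[c, R a)` is in the group. [folklore] -/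
theorem inGroup_of_notInGroup_L {c a : ℤ} (hst : C.Starts c a) (hng : ¬ C.InGroup a (C.L a) c) {c' : ℤ}
    (hc' : C.Active c' a) : C.InGroup a c c' := by
  obtain ⟨-, hR⟩ := notInGroup_L hst hng
  intro g hg1 hg2
  refine ⟨⟨hst.1.1, le_trans hst.1.2.1 hg1, lt_of_le_of_lt hg2 hc'.2.2⟩, fun h => ?_⟩
  unfold Active at h
  omega

/-- **Charged sections are determined by the charged column**: two recorded sections of bottom
row `a` whose predecessors lie strictly left of a column `col ≤` both gaps coincide. [folklore] -/
theorem eq_of_isPred_of_isPred {c c' a cp cp' col : ℤ} (hs : (c, a) ∈ C.secs)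
    (hs' : (c', a) ∈ C.secs) (hp : C.IsPred c a cp) (h1 : cp < col) (h2 : col ≤ c)
    (hp' : C.IsPred c' a cp') (h1' : cp' < col) (h2' : col ≤ c') : c = c' := by
  by_contra hne
  rcases lt_or_gt_of_ne hne with hlt | hlt
  · have hg : C.InGroup a c c' := hp'.2.2.1.mono (by omega) le_rfl
    have := hp'.2.2.2 c hs hlt hg
    omega
  · have hg : C.InGroup a c' c := hp.2.2.1.mono (by omega) le_rfl
    have := hp.2.2.2 c' hs' hlt hg
    omega

/-! ### Every recorded section is charged -/

/-- **Existence of a charge.** [folklore] -/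
theorem exists_rel (hV : C.Valid) {c a : ℤ} (hs : (c, a) ∈ C.secs) : ∃ p, C.Rel c a p := by
  classical
  rcases C.noPred_or_exists_isPred c a with hnp | ⟨cp, hcp⟩
  · by_cases hg : C.InGroup a (C.L a) c
    · exact ⟨(C.L a, a), Or.inl ⟨hnp, rfl, hg⟩⟩
    · exact ⟨(C.R a, a), Or.inr (Or.inl ⟨hnp, rfl, hg⟩)⟩
  · have hcps := hcp.1
    have hlt := hcp.2.1
    have hgrp := hcp.2.2.1
    obtain ⟨b₀, hb₀⟩ := exists_isRun (hgrp cp le_rfl hlt.le)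
    -- the gaps of `(cp, c]` where the run from `a` is not `[a, b₀-1]`
    set X := (Finset.Ioc cp c).filter fun g => ¬ C.IsRun g a b₀ with hX
    rcases X.eq_empty_or_nonempty with hXe | hXne
    · -- all runs agree: section-minimality gives an inner bond
      have hall : ∀ g, cp ≤ g → g ≤ c → C.IsRun g a b₀ := by
        intro g hg1 hg2
        rcases eq_or_lt_of_le hg1 with rfl | hlt1
        · exact hb₀
        · by_contra hnot
          have hgX : g ∈ X := Finset.mem_filter.2 ⟨Finset.mem_Ioc.2 ⟨hlt1, hg2⟩, hnot⟩
          rw [hXe] at hgX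
          exact absurd hgX (Finset.notMem_empty _)
      obtain ⟨p, hp, h1, h2, h3, h4⟩ := hV.sm a b₀ cp c hcps hs hlt hall
      have hr1 : C.Active (p.1 - 1) p.2 := (hall (p.1 - 1) (by omega) (by omega)).2.1 p.2 h3 h4
      have hr2 : C.Active p.1 p.2 := (hall p.1 h1.le h2).2.1 p.2 h3 h4
      refine ⟨p, Or.inr (Or.inr ⟨cp, hcp, h1, h2, Or.inr (Or.inr ⟨?_, hr2.2.2,
        ⟨b₀, hall p.1 h1.le h2, h3, h4⟩, hp⟩)⟩)⟩
      have := hr1.2.1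
      omega
    · -- first gap `gs` where the run changes
      obtain ⟨gs, hgsX, hgsmin⟩ := Finset.exists_min_image X id hXne
      rw [hX, Finset.mem_filter, Finset.mem_Ioc] at hgsX
      obtain ⟨⟨hgs1, hgs2⟩, hnot⟩ := hgsX
      have hbelow : ∀ g, cp ≤ g → g < gs → C.IsRun g a b₀ := by
        intro g hg1 hg2
        rcases eq_or_lt_of_le hg1 with rfl | hlt1
        · exact hb₀
        · by_contra hno
          have hgX : g ∈ X := by
            rw [hX, Finset.mem_filter, Finset.mem_Ioc]
            exact ⟨⟨hlt1, by omega⟩, hno⟩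
          have := hgsmin g hgX
          simp only [id] at this
          omega
      obtain ⟨b', hb'⟩ := exists_isRun (hgrp gs hgs1.le hgs2)
      have hne : b' ≠ b₀ := fun h => hnot (h ▸ hb')
      have hprev : C.IsRun (gs - 1) a b₀ := hbelow (gs - 1) (by omega) (by omega)
      rcases lt_or_gt_of_ne hne with hlt' | hgt'
      · -- the run shrinks: row `b'` ends at column `gs` (a rightmost bond)
        have hact1 : C.Active (gs - 1) b' := hprev.2.1 b' hb'.1.le hlt'
        have hR : C.R b' = gs := R_eq_of_active_of_not_active hV hact1 hb'.2.2.2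
        refine ⟨(gs, b'), Or.inr (Or.inr ⟨cp, hcp, hgs1, hgs2, Or.inr (Or.inl
          ⟨hR.symm, ⟨b₀, hprev, hb'.1, hlt'⟩, ?_⟩)⟩)⟩
        exact hb'.2.1 (b' - 1) (by have := hb'.1; omega) (by omega)
      · -- the run grows: row `b₀` begins at column `gs` (a leftmost bond)
        have hact2 : C.Active gs b₀ := hb'.2.1 b₀ hb₀.1.le hgt'
        have hL : C.L b₀ = gs := L_eq_of_not_active_of_active hV hprev.2.2.2 hact2
        refine ⟨(gs, b₀), Or.inr (Or.inr ⟨cp, hcp, hgs1, hgs2, Or.inl ⟨hL.symm, hprev, ?_, hact2⟩⟩)⟩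
        exact hb'.2.1 (b₀ - 1) (by have := hb₀.1; omega) (by omega)

/-! ### Charges are bonds, and are not unused -/

/-- A charge is a bond. [folklore] -/
theorem Rel.mem_bonds (hV : C.Valid) {c a : ℤ} (hs : (c, a) ∈ C.secs) {p : ℤ × ℤ}
    (h : C.Rel c a p) : p ∈ C.bonds := by
  have ha : a ∈ C.rows := (hV.starts _ hs).1.1
  rcases h with ⟨-, rfl, -⟩ | ⟨-, rfl, -⟩ | ⟨cp, -, -, -, hk⟩
  · exact hV.memL a ha
  · exact hV.memR a ha
  · rcases hk with ⟨hL, -, -, hact⟩ | ⟨hR, ⟨b, hrun, h1, h2⟩, -⟩ | ⟨-, -, -, hp⟩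
    · have := hV.memL p.2 hact.1
      rwa [← hL] at this
    · have hm : p.2 ∈ C.rows := (hrun.2.1 p.2 h1.le h2).1
      have := hV.memR p.2 hm
      rwa [← hR] at this
    · exact hp

/-- **A charge is never an unused bond.** [folklore] -/
theorem Rel.not_unused (hV : C.Valid) {gL gR : ℤ} (hG : ∀ s ∈ C.secs, gL ≤ s.1 ∧ s.1 ≤ gR)
    {c a : ℤ} (hs : (c, a) ∈ C.secs) {p : ℤ × ℤ} (h : C.Rel c a p) : ¬ C.Unused gL gR p := by
  have hst : C.Starts c a := hV.starts _ hs
  have ha : a ∈ C.rows := hst.1.1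
  have hlt := hV.lt a ha
  obtain ⟨hcL, hcR⟩ := hG _ hs
  rcases h with ⟨-, rfl, hg⟩ | ⟨-, rfl, hng⟩ | ⟨cp, hcp, h1, h2, hk⟩
  · -- leftmost bond of the first section of a group reached from `L a`
    rintro (⟨h, -⟩ | ⟨-, hm, hm1⟩ | ⟨h, -⟩ | ⟨h, -⟩) <;> dsimp only at *
    · omega
    · exact (hg gL hm.2.1 hcL).2 hm1
    · omega
    · omega
  · -- rightmost bond of the first section of a group not reached from `L a`
    obtain ⟨hrow, hRle⟩ := notInGroup_L hst hng
    rintro (⟨-, h, -⟩ | ⟨h, -⟩ | ⟨-, -, hm1⟩ | ⟨-, h⟩) <;> dsimp only at *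
    · omega
    · omega
    · unfold Active at hm1
      omega
    · exact h hrow
  · obtain ⟨hcL', -⟩ := hG _ hcp.1
    rcases hk with ⟨hL, -, hact1, hact⟩ | ⟨hR, ⟨b, hrun, hb1, hb2⟩, hact1⟩ | ⟨hL, hR, -, hp⟩
    · have hltm := hV.lt p.2 hact.1
      rintro (⟨h, -⟩ | ⟨-, hm, -⟩ | ⟨h, -⟩ | ⟨h, -⟩)
      · omega
      · unfold Active at hm
        omega
      · omega
      · omega
    · have hm : p.2 ∈ C.rows := (hrun.2.1 p.2 hb1.le hb2).1
      have hltm := hV.lt p.2 hm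
      rintro (⟨-, h, -⟩ | ⟨h, -⟩ | ⟨-, hm', -⟩ | ⟨-, h⟩)
      · omega
      · omega
      · unfold Active at hm'
        omega
      · exact h hact1.1
    · rintro (⟨-, -, h⟩ | ⟨h, -⟩ | ⟨h, -⟩ | ⟨h, -⟩) <;> omega

/-! ### Distinct sections are charged to distinct bonds -/

/-- The five kinds of charged bonds (by the bond alone). [folklore] -/
theorem Rel.kind (hV : C.Valid) {c a : ℤ} (hs : (c, a) ∈ C.secs) {p : ℤ × ℤ} (h : C.Rel c a p) :
    p.2 ∈ C.rows ∧
      ((p.1 = C.L p.2 ∧ ¬ C.Active p.1 (p.2 - 1)) ∨ (p.1 = C.R p.2 ∧ ¬ C.Active p.1 (p.2 - 1)) ∨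
        (p.1 = C.L p.2 ∧ C.Active p.1 (p.2 - 1)) ∨ (p.1 = C.R p.2 ∧ C.Active p.1 (p.2 - 1)) ∨
        (C.L p.2 < p.1 ∧ p.1 < C.R p.2)) := by
  have hst : C.Starts c a := hV.starts _ hs
  have ha : a ∈ C.rows := hst.1.1
  rcases h with ⟨-, rfl, hg⟩ | ⟨-, rfl, hng⟩ | ⟨cp, -, -, -, hk⟩
  · exact ⟨ha, Or.inl ⟨rfl, (hg (C.L a) le_rfl hst.1.2.1).2⟩⟩
  · obtain ⟨hrow, hRle⟩ := notInGroup_L hst hng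
    refine ⟨ha, Or.inr (Or.inl ⟨rfl, fun h => ?_⟩)⟩
    have := hst.1.2.2
    unfold Active at h
    dsimp only at h
    omega
  · rcases hk with ⟨hL, -, hact1, hact⟩ | ⟨hR, ⟨b, hrun, hb1, hb2⟩, hact1⟩ | ⟨hL, hR, -, hp⟩
    · exact ⟨hact.1, Or.inr (Or.inr (Or.inl ⟨hL, hact1⟩))⟩
    · exact ⟨(hrun.2.1 p.2 hb1.le hb2).1, Or.inr (Or.inr (Or.inr (Or.inl ⟨hR, hact1⟩)))⟩
    · exact ⟨(hV.bond p hp).1, Or.inr (Or.inr (Or.inr (Or.inr ⟨hL, hR⟩)))⟩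

/-- A bond of the first kind is charged only as the leftmost bond of a first section. [folklore] -/
theorem Rel.of_kind₁ (hV : C.Valid) {c a : ℤ} (hs : (c, a) ∈ C.secs) {p : ℤ × ℤ}
    (h : C.Rel c a p) (hk : p.1 = C.L p.2 ∧ ¬ C.Active p.1 (p.2 - 1)) :
    C.NoPred c a ∧ p.2 = a ∧ C.InGroup a (C.L a) c := by
  have hm := (h.kind hV hs).1
  have hltm := hV.lt p.2 hm
  rcases h with ⟨hnp, rfl, hg⟩ | ⟨-, rfl, -⟩ | ⟨cp, -, -, -, hk'⟩
  · exact ⟨hnp, rfl, hg⟩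
  · exfalso; dsimp only at *; omega
  · exfalso
    rcases hk' with ⟨-, -, hact1, -⟩ | ⟨hR, -, -⟩ | ⟨hL, -, -, -⟩
    · exact hk.2 hact1
    · omega
    · omega

/-- A bond of the second kind is charged only as the rightmost bond of a first section. [folklore] -/
theorem Rel.of_kind₂ (hV : C.Valid) {c a : ℤ} (hs : (c, a) ∈ C.secs) {p : ℤ × ℤ}
    (h : C.Rel c a p) (hk : p.1 = C.R p.2 ∧ ¬ C.Active p.1 (p.2 - 1)) :
    C.NoPred c a ∧ p.2 = a ∧ ¬ C.InGroup a (C.L a) c := by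
  have hm := (h.kind hV hs).1
  have hltm := hV.lt p.2 hm
  rcases h with ⟨-, rfl, -⟩ | ⟨hnp, rfl, hng⟩ | ⟨cp, -, -, -, hk'⟩
  · exfalso; dsimp only at *; omega
  · exact ⟨hnp, rfl, hng⟩
  · exfalso
    rcases hk' with ⟨hL, -, -, -⟩ | ⟨-, -, hact1⟩ | ⟨-, hR, -, -⟩
    · omega
    · exact hk.2 hact1
    · omega

/-- A bond of the last three kinds is charged only against a predecessor, and determines the
bottom row through a run containing a given row. [folklore] -/
theorem Rel.of_kind₃₄₅ (hV : C.Valid) {c a : ℤ} (hs : (c, a) ∈ C.secs) {p : ℤ × ℤ}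
    (h : C.Rel c a p)
    (hk : (p.1 = C.L p.2 ∧ C.Active p.1 (p.2 - 1)) ∨ (p.1 = C.R p.2 ∧ C.Active p.1 (p.2 - 1)) ∨
      (C.L p.2 < p.1 ∧ p.1 < C.R p.2)) :
    ∃ cp, C.IsPred c a cp ∧ cp < p.1 ∧ p.1 ≤ c ∧
      ((p.1 = C.L p.2 ∨ p.1 = C.R p.2) ∧ (∃ b, C.IsRun (p.1 - 1) a b ∧ a ≤ p.2 - 1 ∧ p.2 - 1 < b) ∨
        C.L p.2 < p.1 ∧ p.1 < C.R p.2 ∧ ∃ b, C.IsRun p.1 a b ∧ a ≤ p.2 ∧ p.2 < b) := by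
  have hst : C.Starts c a := hV.starts _ hs
  have hm := (h.kind hV hs).1
  have hltm := hV.lt p.2 hm
  rcases h with ⟨-, rfl, hg⟩ | ⟨-, rfl, hng⟩ | ⟨cp, hcp, h1, h2, hk'⟩
  · exfalso
    have := (hg (C.L a) le_rfl hst.1.2.1).2
    dsimp only at *
    rcases hk with ⟨-, h⟩ | ⟨h, -⟩ | ⟨h, -⟩
    · exact this h
    · omega
    · omega
  · exfalso
    obtain ⟨hrow, hRle⟩ := notInGroup_L hst hng
    have hc := hst.1.2.2
    dsimp only at *
    rcases hk with ⟨h, -⟩ | ⟨-, h⟩ | ⟨-, h⟩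
    · omega
    · unfold Active at h
      omega
    · omega
  · refine ⟨cp, hcp, h1, h2, ?_⟩
    rcases hk' with ⟨hL, hrun, -, -⟩ | ⟨hR, ⟨b, hrun, hb1, hb2⟩, -⟩ | ⟨hL, hR, hrun, -⟩
    · exact Or.inl ⟨Or.inl hL, p.2, hrun, by have := hrun.1; omega, by omega⟩
    · exact Or.inl ⟨Or.inr hR, b, hrun, by omega, by omega⟩
    · exact Or.inr ⟨hL, hR, hrun⟩

/-- **Distinct recorded sections are charged to distinct bonds.** [folklore] -/
theorem rel_subsingleton (hV : C.Valid) {c a c' a' : ℤ} (hs : (c, a) ∈ C.secs)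
    (hs' : (c', a') ∈ C.secs) {p : ℤ × ℤ} (h : C.Rel c a p) (h' : C.Rel c' a' p) :
    c = c' ∧ a = a' := by
  obtain ⟨hm, hk⟩ := h.kind hV hs
  have hltm := hV.lt p.2 hm
  rcases hk with hk | hk | hk
  · -- leftmost bonds of first sections
    obtain ⟨hnp, rfl, hg⟩ := h.of_kind₁ hV hs hk
    obtain ⟨hnp', hpa, hg'⟩ := h'.of_kind₁ hV hs' hk
    subst hpa
    refine ⟨?_, rfl⟩
    have hLc : C.L p.2 ≤ c := (hV.starts _ hs).1.2.1
    have hLc' : C.L p.2 ≤ c' := (hV.starts _ hs').1.2.1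
    by_contra hne
    rcases lt_or_gt_of_ne hne with hlt | hlt
    · exact hnp' c hs hlt (hg'.mono hLc le_rfl)
    · exact hnp c' hs' hlt (hg.mono hLc' le_rfl)
  · -- rightmost bonds of first sections
    obtain ⟨hnp, rfl, hng⟩ := h.of_kind₂ hV hs hk
    obtain ⟨hnp', hpa, hng'⟩ := h'.of_kind₂ hV hs' hk
    subst hpa
    refine ⟨?_, rfl⟩
    by_contra hne
    rcases lt_or_gt_of_ne hne with hlt | hlt
    · exact hnp' c hs hlt (inGroup_of_notInGroup_L (hV.starts _ hs) hng (hV.starts _ hs').1)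
    · exact hnp c' hs' hlt (inGroup_of_notInGroup_L (hV.starts _ hs') hng' (hV.starts _ hs).1)
  · -- charged bonds: the run through the bond's row determines the bottom row
    obtain ⟨cp, hcp, h1, h2, hr⟩ := h.of_kind₃₄₅ hV hs hk
    obtain ⟨cp', hcp', h1', h2', hr'⟩ := h'.of_kind₃₄₅ hV hs' hk
    have haa : a = a' := by
      rcases hr with ⟨hLR, b, hrun, hj1, hj2⟩ | ⟨hL, hR, b, hrun, hj1, hj2⟩ <;>
        rcases hr' with ⟨hLR', b', hrun', hj1', hj2'⟩ | ⟨hL', hR', b', hrun', hj1', hj2'⟩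
      · exact (hrun.eq_of_mem hrun' ⟨hj1, hj2⟩ ⟨hj1', hj2'⟩).1
      · exfalso; rcases hLR with h | h <;> omega
      · exfalso; rcases hLR' with h | h <;> omega
      · exact (hrun.eq_of_mem hrun' ⟨hj1, hj2⟩ ⟨hj1', hj2'⟩).1
    subst haa
    exact ⟨eq_of_isPred_of_isPred hs hs' hcp h1 h2 hcp' h1' h2', rfl⟩

/-! ### The count -/

open Classical in
/-- **The census inequality**: recorded sections between the gaps `gL ≤ gR` are at most as many
as the bonds that are not unused. [folklore] -/
theorem card_secs_le_card (hV : C.Valid) {gL gR : ℤ} (hG : ∀ s ∈ C.secs, gL ≤ s.1 ∧ s.1 ≤ gR) :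
    C.secs.card ≤ (C.bonds.filter fun p => ¬ C.Unused gL gR p).card := by
  refine Finset.card_le_card_of_forall_subsingleton (fun s p => C.Rel s.1 s.2 p) ?_ ?_
  · rintro ⟨c, a⟩ hs
    obtain ⟨p, hp⟩ := exists_rel hV hs
    exact ⟨p, Finset.mem_filter.2 ⟨hp.mem_bonds hV hs, hp.not_unused hV hG hs⟩, hp⟩
  · rintro p - ⟨c, a⟩ ⟨hs, hr⟩ ⟨c', a'⟩ ⟨hs', hr'⟩
    obtain ⟨h1, h2⟩ := rel_subsingleton hV hs hs' hr hr'
    rw [h1, h2]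

end Census

/-! ## Part 2: the census of a polygon word

### Vertical letters: coordinates and edge simplicity -/

open Edwards2D Literature.Probability.LatticeModels Literature.Probability.Percolation

variable {w : List (Fin 4)}

/-- A vertical letter is `N` or `S`. [folklore] -/
theorem eq_two_or_eq_three_of_le {a : Fin 4} (ha : 2 ≤ a.val) : a = 2 ∨ a = 3 := by
  fin_cases a <;> simp at ha ⊢

/-- The vertex after an `N`. [folklore] -/
theorem vtx_succ_of_N {i : ℕ} (hi : i < w.length) (ha : w.getD i 0 = 2) :
    vtx w (i + 1) 0 = vtx w i 0 ∧ vtx w (i + 1) 1 = vtx w i 1 + 1 := by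
  rw [vtx_succ w hi, ← List.getD_eq_getElem w 0 hi, ha, Pi.add_apply, Pi.add_apply]
  simp

/-- The vertex after an `S`. [folklore] -/
theorem vtx_succ_of_S {i : ℕ} (hi : i < w.length) (ha : w.getD i 0 = 3) :
    vtx w (i + 1) 0 = vtx w i 0 ∧ vtx w (i + 1) 1 = vtx w i 1 - 1 := by
  rw [vtx_succ w hi, ← List.getD_eq_getElem w 0 hi, ha, Pi.add_apply, Pi.add_apply]
  simp [sub_eq_add_neg]

/-- **Edge simplicity, vertical**: a SAP word traverses each vertical edge at most once — two
vertical letters in the same column and the same row have the same index. [folklore] -/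
theorem IsSAP.eq_of_row_eq (h : IsSAP w) {K K' : ℕ} (hK : K < w.length) (hK' : K' < w.length)
    (ha : 2 ≤ (w.getD K 0).val) (ha' : 2 ≤ (w.getD K' 0).val) (hx : vtx w K 0 = vtx w K' 0)
    (hr : rowOf (vtx w K 1) (w.getD K 0) = rowOf (vtx w K' 1) (w.getD K' 0)) : K = K' := by
  have hN := h.1
  -- same direction: same starting vertex
  have same : ∀ K K', K < w.length → K' < w.length → vtx w K 0 = vtx w K' 0 →
      vtx w K 1 = vtx w K' 1 → K = K' := by
    intro K K' hK hK' h0 h1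
    exact h.2.2 (Set.mem_Iio.2 hK) (Set.mem_Iio.2 hK') (site_eq_iff.2 ⟨h0, h1⟩)
  -- opposite directions: the walk would backtrack along the edge
  have opp : ∀ K K', K < w.length → K' < w.length → w.getD K 0 = 2 → w.getD K' 0 = 3 →
      vtx w K 0 = vtx w K' 0 → vtx w K 1 = vtx w K' 1 - 1 → False := by
    intro K K' hK hK' h0 h1 hx hy
    have hvK : vtx w (K + 1) = vtx w K' := by
      obtain ⟨e0, e1⟩ := vtx_succ_of_N hK h0
      rw [site_eq_iff, e0, e1]
      constructor <;> omega
    have hvK' : vtx w (K' + 1) = vtx w K := by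
      obtain ⟨e0, e1⟩ := vtx_succ_of_S hK' h1
      rw [site_eq_iff, e0, e1]
      constructor <;> omega
    have m1 := h.mod_eq_mod (i := K + 1) (j := K') hK hK'.le hvK
    have m2 := h.mod_eq_mod (i := K' + 1) (j := K) hK' hK.le hvK'
    rw [Nat.mod_eq_of_lt hK'] at m1
    rw [Nat.mod_eq_of_lt hK] at m2
    rcases (show K + 1 < w.length ∨ K + 1 = w.length by omega) with h3 | h3 <;>
      rcases (show K' + 1 < w.length ∨ K' + 1 = w.length by omega) with h4 | h4
    · rw [Nat.mod_eq_of_lt h3] at m1; rw [Nat.mod_eq_of_lt h4] at m2; omega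
    · rw [Nat.mod_eq_of_lt h3] at m1; rw [h4, Nat.mod_self] at m2; omega
    · rw [h3, Nat.mod_self] at m1; rw [Nat.mod_eq_of_lt h4] at m2; omega
    · rw [h3, Nat.mod_self] at m1; rw [h4, Nat.mod_self] at m2; omega
  rcases eq_two_or_eq_three_of_le ha with h0 | h0 <;>
    rcases eq_two_or_eq_three_of_le ha' with h1 | h1 <;>
    simp only [h0, h1, rowOf_N, rowOf_S] at hr
  · exact same K K' hK hK' hx hr
  · exact (opp K K' hK hK' h0 h1 hx (by omega)).elim
  · exact (opp K' K hK' hK h1 h0 hx.symm (by omega)).elim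
  · exact same K K' hK hK' hx (by omega)

/-! ### Rows, extreme bonds, bonds as pairs -/

/-- The rows of `w` carrying vertical bonds. [folklore] -/
def rowsW (w : List (Fin 4)) : Finset ℤ :=
  ((Finset.range w.length).filter fun i => 2 ≤ (w.getD i 0).val).image
    fun i => rowOf (vtx w i 1) (w.getD i 0)

/-- A row is in `rowsW` iff it has a vertical bond. [folklore] -/
theorem mem_rowsW {j : ℤ} : j ∈ rowsW w ↔ (rowCols w j).Nonempty := by
  constructor
  · intro h
    simp only [rowsW, Finset.mem_image, Finset.mem_filter, Finset.mem_range] at h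
    obtain ⟨i, ⟨hi, hv⟩, hr⟩ := h
    exact ⟨vtx w i 0, mem_rowCols.2 ⟨i, hi, hv, hr, rfl⟩⟩
  · rintro ⟨c, hc⟩
    obtain ⟨i, hi, hv, hr, -⟩ := mem_rowCols.1 hc
    simp only [rowsW, Finset.mem_image, Finset.mem_filter, Finset.mem_range]
    exact ⟨i, ⟨hi, hv⟩, hr⟩

/-- The vertical bonds of `w` as pairs `(column, row)`. [folklore] -/
def bondsW (w : List (Fin 4)) : Finset (ℤ × ℤ) :=
  ((Finset.range w.length).filter fun i => 2 ≤ (w.getD i 0).val).image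
    fun i => (vtx w i 0, rowOf (vtx w i 1) (w.getD i 0))

/-- Membership in `bondsW`. [folklore] -/
theorem mem_bondsW {p : ℤ × ℤ} : p ∈ bondsW w ↔ p.1 ∈ rowCols w p.2 := by
  constructor
  · intro h
    simp only [bondsW, Finset.mem_image, Finset.mem_filter, Finset.mem_range] at h
    obtain ⟨i, ⟨hi, hv⟩, rfl⟩ := h
    exact mem_rowCols.2 ⟨i, hi, hv, rfl, rfl⟩
  · intro h
    obtain ⟨i, hi, hv, hr, hc⟩ := mem_rowCols.1 h
    simp only [bondsW, Finset.mem_image, Finset.mem_filter, Finset.mem_range]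
    exact ⟨i, ⟨hi, hv⟩, by rw [hc, hr]⟩

/-- There are at most `vcount w` bonds (in fact exactly, by edge simplicity). [folklore] -/
theorem card_bondsW_le (w : List (Fin 4)) : (bondsW w).card ≤ vcount w := by
  rw [← card_filter_vertical]
  exact Finset.card_image_le

/-- The column of the leftmost vertical bond of row `j` (junk `0` on empty rows). [folklore] -/
def Lw (w : List (Fin 4)) (j : ℤ) : ℤ :=
  if h : (rowCols w j).Nonempty then (rowCols w j).min' h else 0

/-- The column of the rightmost vertical bond of row `j` (junk `0` on empty rows). [folklore] -/
def Rw (w : List (Fin 4)) (j : ℤ) : ℤ :=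
  if h : (rowCols w j).Nonempty then (rowCols w j).max' h else 0

/-- `Lw` is a lower bound of the bond columns of the row. [folklore] -/
theorem Lw_le {j c : ℤ} (hc : c ∈ rowCols w j) : Lw w j ≤ c := by
  have hne : (rowCols w j).Nonempty := ⟨c, hc⟩
  rw [Lw, dif_pos hne]
  exact Finset.min'_le _ _ hc

/-- `Rw` is an upper bound of the bond columns of the row. [folklore] -/
theorem le_Rw {j c : ℤ} (hc : c ∈ rowCols w j) : c ≤ Rw w j := by
  have hne : (rowCols w j).Nonempty := ⟨c, hc⟩
  rw [Rw, dif_pos hne]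
  exact Finset.le_max' _ _ hc

/-- `Lw` is a bond column of a non-empty row. [folklore] -/
theorem Lw_mem {j : ℤ} (hne : (rowCols w j).Nonempty) : Lw w j ∈ rowCols w j := by
  rw [Lw, dif_pos hne]
  exact Finset.min'_mem _ _

/-- `Rw` is a bond column of a non-empty row. [folklore] -/
theorem Rw_mem {j : ℤ} (hne : (rowCols w j).Nonempty) : Rw w j ∈ rowCols w j := by
  rw [Rw, dif_pos hne]
  exact Finset.max'_mem _ _

/-- Row `j` is **active** at the gap `g`: `Lw j ≤ g < Rw j` (and the row is non-empty). [folklore] -/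
def ActiveW (w : List (Fin 4)) (g j : ℤ) : Prop :=
  j ∈ rowsW w ∧ Lw w j ≤ g ∧ g < Rw w j

/-- **Active = not crossed**: a row is active at a gap iff no section line of that row crosses
the gap. [folklore] -/
theorem activeW_iff_not_crosses {g j : ℤ} : ActiveW w g j ↔ ¬ Crosses w g j := by
  constructor
  · rintro ⟨hj, hL, hR⟩ hc
    have hne := mem_rowsW.1 hj
    rcases hc with hl | hr
    · have := hl _ (Lw_mem hne)
      omega
    · have := hr _ (Rw_mem hne)
      omega
  · intro h
    have hl : ¬ CrossL w g j := fun hc => h (Or.inl hc)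
    have hr : ¬ CrossR w g j := fun hc => h (Or.inr hc)
    unfold CrossL at hl
    unfold CrossR at hr
    push Not at hl hr
    obtain ⟨c, hc, hcg⟩ := hl
    obtain ⟨c', hc', hcg'⟩ := hr
    have h1 := Lw_le hc
    have h2 := le_Rw hc'
    exact ⟨mem_rowsW.2 ⟨c, hc⟩, by omega, by omega⟩

/-- **Every non-empty row has two distinct bond columns**: `Lw j < Rw j` (crossing parity: the
number of vertical letters of a row is even, and two of them in one column would be one edge
traversed twice). [folklore] -/
theorem IsSAP.Lw_lt_Rw (h : IsSAP w) {j : ℤ} (hne : (rowCols w j).Nonempty) : Lw w j < Rw w j := by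
  classical
  have hcR : CrossR w (Rw w j) j := fun c hc => le_Rw hc
  have hp1 := even_card_hBelow_add_card_vRight h.2.1 (Rw w j) j
  rw [vRight_eq_empty_of_crossR hcR, Finset.card_empty, add_zero] at hp1
  have hp2 := even_card_hBelow_add_card_vLeft h.2.1 (Rw w j) j
  have heven : Even (vLeft w (Rw w j) j).card := by
    obtain ⟨r, hr⟩ := hp1
    obtain ⟨s, hs⟩ := hp2
    exact ⟨s - r, by omega⟩
  have hne' : (vLeft w (Rw w j) j).Nonempty := vLeft_nonempty_iff.2 ⟨Rw w j, Rw_mem hne, le_rfl⟩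
  have htwo : 1 < (vLeft w (Rw w j) j).card := by
    have := Finset.card_pos.2 hne'
    obtain ⟨r, hr⟩ := heven
    omega
  obtain ⟨i₁, h₁, i₂, h₂, hne12⟩ := Finset.one_lt_card.1 htwo
  simp only [vLeft, Finset.mem_filter, Finset.mem_range] at h₁ h₂
  have hcol : vtx w i₁ 0 ≠ vtx w i₂ 0 := fun heq =>
    hne12 (h.eq_of_row_eq h₁.1 h₂.1 h₁.2.1 h₂.2.1 heq (h₁.2.2.1.trans h₂.2.2.1.symm))
  have hm₁ : vtx w i₁ 0 ∈ rowCols w j := mem_rowCols.2 ⟨i₁, h₁.1, h₁.2.1, h₁.2.2.1, rfl⟩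
  have hm₂ : vtx w i₂ 0 ∈ rowCols w j := mem_rowCols.2 ⟨i₂, h₂.1, h₂.2.1, h₂.2.2.1, rfl⟩
  have a₁ := Lw_le hm₁
  have a₂ := Lw_le hm₂
  have b₁ := le_Rw hm₁
  have b₂ := le_Rw hm₂
  omega

/-- A bond of a row inactive at the two gaps around its column does not exist. [folklore] -/
theorem not_mem_rowCols_of_not_activeW (h : IsSAP w) {col m : ℤ} (h1 : ¬ ActiveW w (col - 1) m)
    (h2 : ¬ ActiveW w col m) : col ∉ rowCols w m := by
  intro hc
  have hne : (rowCols w m).Nonempty := ⟨col, hc⟩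
  have hlt := h.Lw_lt_Rw hne
  have hL := Lw_le hc
  have hR := le_Rw hc
  have hm := mem_rowsW.2 hne
  unfold ActiveW at h1 h2
  have : ¬ (Lw w m ≤ col - 1 ∧ col - 1 < Rw w m) := fun h' => h1 ⟨hm, h'⟩
  have : ¬ (Lw w m ≤ col ∧ col < Rw w m) := fun h' => h2 ⟨hm, h'⟩
  omega

/-! ### Passing straight through a vertex without vertical bonds -/

/-- No vertical bond of `w` is incident to the vertex `(col, y)`: none in column `col` in the
rows `[y-1, y]` and `[y, y+1]`. [folklore] -/
def NoVert (w : List (Fin 4)) (col y : ℤ) : Prop :=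
  col ∉ rowCols w (y - 1) ∧ col ∉ rowCols w y

/-- **No backtracking**: two consecutive horizontal letters of a SAP word are equal. [folklore] -/
theorem IsSAP.getD_succ_eq (h : IsSAP w) {j : ℕ} (hj : j + 1 < w.length)
    (hv0 : (w.getD j 0).val < 2) (hv1 : (w.getD (j + 1) 0).val < 2) :
    w.getD (j + 1) 0 = w.getD j 0 := by
  have hj' : j < w.length := by omega
  by_contra hne
  have hsum : stepVec (w.getD j 0) + stepVec (w.getD (j + 1) 0) = 0 := by
    generalize w.getD j 0 = a at *
    generalize w.getD (j + 1) 0 = b at *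
    fin_cases a <;> fin_cases b <;> simp at hv0 hv1 hne ⊢
  have hv : vtx w (j + 2) = vtx w j := by
    rw [show j + 2 = j + 1 + 1 by ring, vtx_succ w hj, vtx_succ w hj', add_assoc,
      ← List.getD_eq_getElem w 0 hj', ← List.getD_eq_getElem w 0 hj, hsum, add_zero]
  have hm := h.mod_eq_mod (show j + 2 ≤ w.length by omega) hj'.le hv
  rw [Nat.mod_eq_of_lt hj'] at hm
  have h4 := h.1
  rcases (show j + 2 < w.length ∨ j + 2 = w.length by omega) with hlt | heq
  · rw [Nat.mod_eq_of_lt hlt] at hm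
    omega
  · rw [heq, Nat.mod_self] at hm
    omega

/-- The closing bond of a canonical word is the vertical bond of column `0` in row `0` (the last
letter `S`, from `(0,1)` into the root). [folklore] -/
theorem IsCanon.zero_mem_rowCols_zero (h : IsCanon w) : (0 : ℤ) ∈ rowCols w 0 := by
  have hN : w.length - 1 < w.length := by have := h.1.1; omega
  obtain ⟨h3, h0⟩ := h.getD_length_sub_one
  have h1 : vtx w (w.length - 1) 1 = 1 := by
    have := (vtx_succ_of_S hN h3).2
    rw [Nat.sub_add_cancel (by have := h.1.1; omega), vtx_length, h.1.2.1] at this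
    simp only [Pi.zero_apply] at this
    omega
  exact mem_rowCols.2 ⟨w.length - 1, hN, by rw [h3]; decide, by rw [h3, rowOf_S, h1]; norm_num, h0⟩

/-- **Straight on**: a horizontal letter arriving at a vertex without vertical bonds is followed
by the same letter. [folklore] -/
theorem IsCanon.straight_next (h : IsCanon w) {i : ℕ} (hi : i < w.length)
    (hh : (w.getD i 0).val < 2) (hv : NoVert w (vtx w (i + 1) 0) (vtx w (i + 1) 1)) :
    i + 1 < w.length ∧ w.getD (i + 1) 0 = w.getD i 0 := by
  have hlt : i + 1 < w.length := by
    by_contra hge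
    have heq : i = w.length - 1 := by omega
    have h3 := h.getD_length_sub_one.1
    rw [← heq] at h3
    rw [h3] at hh
    exact absurd hh (by decide)
  refine ⟨hlt, h.1.getD_succ_eq hlt hh ?_⟩
  by_contra hv1
  push Not at hv1
  rcases eq_two_or_eq_three_of_le hv1 with h2 | h3
  · exact hv.2 (mem_rowCols.2 ⟨i + 1, hlt, hv1, by rw [h2, rowOf_N], rfl⟩)
  · exact hv.1 (mem_rowCols.2 ⟨i + 1, hlt, hv1, by rw [h3, rowOf_S], rfl⟩)

/-- **Straight back**: a horizontal letter leaving a vertex without vertical bonds is preceded by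
the same letter. [folklore] -/
theorem IsCanon.straight_prev (h : IsCanon w) {i : ℕ} (hi : i < w.length)
    (hh : (w.getD i 0).val < 2) (hv : NoVert w (vtx w i 0) (vtx w i 1)) :
    ∃ j, i = j + 1 ∧ w.getD j 0 = w.getD i 0 := by
  rcases Nat.eq_zero_or_pos i with rfl | hpos
  · exfalso
    apply hv.2
    rw [vtx_zero, Pi.zero_apply, Pi.zero_apply]
    exact h.zero_mem_rowCols_zero
  · obtain ⟨j, rfl⟩ : ∃ j, i = j + 1 := ⟨i - 1, by omega⟩
    have hj : j < w.length := by omega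
    refine ⟨j, rfl, (h.1.getD_succ_eq hi ?_ hh).symm⟩
    by_contra hv0
    push Not at hv0
    rcases eq_two_or_eq_three_of_le hv0 with h2 | h3
    · obtain ⟨e0, e1⟩ := vtx_succ_of_N hj h2
      exact hv.1 (mem_rowCols.2 ⟨j, hj, hv0, by rw [h2, rowOf_N]; omega, by omega⟩)
    · obtain ⟨e0, e1⟩ := vtx_succ_of_S hj h3
      exact hv.2 (mem_rowCols.2 ⟨j, hj, hv0, by rw [h3, rowOf_S]; omega, by omega⟩)

/-- **Horizontal bonds pass through a vertex without vertical bonds**: the gaps on both sides of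
such a vertex carry a horizontal bond at its height, or neither does. [folklore] -/
theorem IsCanon.mem_gapHeights_sub_one_iff (h : IsCanon w) {col y : ℤ} (hv : NoVert w col y) :
    y ∈ gapHeights w (col - 1) ↔ y ∈ gapHeights w col := by
  constructor
  · intro hy
    obtain ⟨i, hi, hh, hg, hyi⟩ := mem_gapHeights.1 hy
    rcases eq_zero_or_eq_one_of_lt hh with hE | hW
    · -- an `E` from `(col-1, y)` arrives at `(col, y)` and goes on eastwards
      rw [hE, gapOf_E] at hg
      have e0 := vtx_succ_zero_of_E hi hE
      have e1 := vtx_succ_one_of_lt hi hh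
      have hv' : NoVert w (vtx w (i + 1) 0) (vtx w (i + 1) 1) := by
        rw [e0, e1, hg, hyi, sub_add_cancel]
        exact hv
      obtain ⟨hlt, heq⟩ := h.straight_next hi hh hv'
      refine mem_gapHeights.2 ⟨i + 1, hlt, by rw [heq]; exact hh, ?_, by rw [e1, hyi]⟩
      rw [heq, hE, gapOf_E, e0, hg]
      ring
    · -- a `W` leaves `(col, y)`: it came from `(col+1, y)` by a `W`
      rw [hW, gapOf_W] at hg
      have hx : vtx w i 0 = col := by omega
      have hv' : NoVert w (vtx w i 0) (vtx w i 1) := by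
        rw [hx, hyi]
        exact hv
      obtain ⟨j, rfl, heq⟩ := h.straight_prev hi hh hv'
      have hj : j < w.length := by omega
      rw [hW] at heq
      have e0 := vtx_succ_zero_of_W hj heq
      have e1 := vtx_succ_one_of_lt hj (by rw [heq]; decide)
      refine mem_gapHeights.2 ⟨j, hj, by rw [heq]; decide, ?_, by rw [← e1]; exact hyi⟩
      rw [heq, gapOf_W]
      omega
  · intro hy
    obtain ⟨i, hi, hh, hg, hyi⟩ := mem_gapHeights.1 hy
    rcases eq_zero_or_eq_one_of_lt hh with hE | hW
    · -- an `E` leaves `(col, y)`: it came from `(col-1, y)` by an `E`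
      rw [hE, gapOf_E] at hg
      have hv' : NoVert w (vtx w i 0) (vtx w i 1) := by
        rw [hg, hyi]
        exact hv
      obtain ⟨j, rfl, heq⟩ := h.straight_prev hi hh hv'
      have hj : j < w.length := by omega
      rw [hE] at heq
      have e0 := vtx_succ_zero_of_E hj heq
      have e1 := vtx_succ_one_of_lt hj (by rw [heq]; decide)
      refine mem_gapHeights.2 ⟨j, hj, by rw [heq]; decide, ?_, by rw [← e1]; exact hyi⟩
      rw [heq, gapOf_E]
      omega
    · -- a `W` from `(col+1, y)` arrives at `(col, y)` and goes on westwards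
      rw [hW, gapOf_W] at hg
      have e0 := vtx_succ_zero_of_W hi hW
      have e1 := vtx_succ_one_of_lt hi hh
      have hv' : NoVert w (vtx w (i + 1) 0) (vtx w (i + 1) 1) := by
        rw [e0, e1, hyi, show vtx w i 0 - 1 = col by omega]
        exact hv
      obtain ⟨hlt, heq⟩ := h.straight_next hi hh hv'
      refine mem_gapHeights.2 ⟨i + 1, hlt, by rw [heq]; exact hh, ?_, by rw [e1, hyi]⟩
      rw [heq, hW, gapOf_W, e0]
      omega

/-! ### Sections over a run; the duplicate produced by a bond-free column -/

/-- **The heights of a section over a run**: if no section line crosses the gap at the rows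
`y₀ ≤ j < b` and one crosses at the row `b ≥ y₀`, the section led by `y₀` consists of the heights
of the gap in `[y₀, b]`. [folklore] -/
theorem secHeights_eq_filter {g y₀ b : ℤ} (hnc : ∀ j, y₀ ≤ j → j < b → ¬ Crosses w g j)
    (hb : Crosses w g b) (hyb : y₀ ≤ b) :
    secHeights w g y₀ = (gapHeights w g).filter fun y' => y₀ ≤ y' ∧ y' ≤ b := by
  classical
  ext y'
  rw [mem_secHeights, Finset.mem_filter]
  constructor
  · rintro ⟨hg, h1, hns⟩
    refine ⟨hg, h1, ?_⟩
    by_contra hlt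
    exact hns ⟨b, hyb, by omega, hb⟩
  · rintro ⟨hg, h1, h2⟩
    refine ⟨hg, h1, ?_⟩
    rintro ⟨j, hj1, hj2, hc⟩
    exact hnc j hj1 (by omega) hc

/-- **Leaders over a run**: a height `y₀ ≥ a` of the gap with a crossing section line at the row
`a-1` and no height of the gap in `[a, y₀)` leads a section. [folklore] -/
theorem isLeader_of_crosses {g a y₀ : ℤ} (hy : y₀ ∈ gapHeights w g) (hay : a ≤ y₀)
    (ha : Crosses w g (a - 1)) (hno : ∀ y' ∈ gapHeights w g, a ≤ y' → y' < y₀ → False) :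
    IsLeader w g y₀ := by
  refine ⟨hy, fun y' hy' hlt => ?_⟩
  by_cases h : y' < a
  · exact ⟨a - 1, by omega, by omega, ha⟩
  · exact absurd (hno y' hy' (by omega) hlt) not_false

/-- **A bond-free column inside a page duplicates the section** (the mechanism of Lemma 5 and
Lemma 7: "otherwise the horizontal bonds in both sections would be the same and they would be
duplicate sections"). If the section of the gap `c` led by `y₀` lies over the run `[a, b-1]`,
the same rows form a run at the gap `c+1`, and the column `c+1` carries no vertical bond in the
rows `[a, b-1]`, then `(c+1, y₀)` is a duplicate section. [cite: Rechnitzer2006Haruspicy2, §2.2, Lemma 7 (proof)] -/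
theorem IsCanon.isDup_of_noBond (h : IsCanon w) {c a b y₀ : ℤ} (hl : IsLeader w c y₀)
    (hay : a ≤ y₀) (hyb : y₀ < b)
    (hrun : ∀ j, a ≤ j → j < b → ActiveW w c j ∧ ActiveW w (c + 1) j)
    (hbot : ¬ ActiveW w c (a - 1) ∧ ¬ ActiveW w (c + 1) (a - 1))
    (htop : ¬ ActiveW w c b ∧ ¬ ActiveW w (c + 1) b)
    (H : ∀ m, a ≤ m → m < b → c + 1 ∉ rowCols w m) : IsDup w (c + 1) y₀ := by
  -- no vertical bond in column `c+1` in the rows `a-1 … b`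
  have hNoV : ∀ m, a - 1 ≤ m → m ≤ b → c + 1 ∉ rowCols w m := by
    intro m h1 h2
    rcases (show m = a - 1 ∨ (a ≤ m ∧ m < b) ∨ m = b by omega) with rfl | ⟨h3, h4⟩ | rfl
    · exact not_mem_rowCols_of_not_activeW h.1 (by rw [add_sub_cancel_right]; exact hbot.1) hbot.2
    · exact H m h3 h4
    · exact not_mem_rowCols_of_not_activeW h.1 (by rw [add_sub_cancel_right]; exact htop.1) htop.2
  have htr : ∀ y, a ≤ y → y ≤ b → (y ∈ gapHeights w c ↔ y ∈ gapHeights w (c + 1)) := by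
    intro y h1 h2
    have := h.mem_gapHeights_sub_one_iff (col := c + 1) (y := y)
      ⟨hNoV (y - 1) (by omega) (by omega), hNoV y (by omega) h2⟩
    rwa [add_sub_cancel_right] at this
  -- crossing pattern at both gaps
  have hnc : ∀ j, a ≤ j → j < b → ¬ Crosses w c j ∧ ¬ Crosses w (c + 1) j := fun j h1 h2 =>
    ⟨activeW_iff_not_crosses.1 (hrun j h1 h2).1, activeW_iff_not_crosses.1 (hrun j h1 h2).2⟩
  have hcr : ∀ {g j}, ¬ ActiveW w g j → Crosses w g j := fun hna => by
    by_contra hc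
    exact hna (activeW_iff_not_crosses.2 hc)
  -- no height of the gap `c` in `[a, y₀)`
  have hno : ∀ y' ∈ gapHeights w c, a ≤ y' → y' < y₀ → False := by
    intro y' hy' h1 h2
    obtain ⟨j, hj1, hj2, hc⟩ := hl.2 y' hy' h2
    exact (hnc j (by omega) (by omega)).1 hc
  have hS : secHeights w c y₀ = (gapHeights w c).filter fun y' => y₀ ≤ y' ∧ y' ≤ b :=
    secHeights_eq_filter (fun j h1 h2 => (hnc j (by omega) h2).1) (hcr htop.1) hyb.le
  have hS1 : secHeights w (c + 1) y₀ = (gapHeights w (c + 1)).filter fun y' => y₀ ≤ y' ∧ y' ≤ b :=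
    secHeights_eq_filter (fun j h1 h2 => (hnc j (by omega) h2).2) (hcr htop.2) hyb.le
  have hl1 : IsLeader w (c + 1) y₀ :=
    isLeader_of_crosses ((htr y₀ hay hyb.le).1 hl.1) hay (hcr hbot.2)
      fun y' hy' h1 h2 => hno y' ((htr y' h1 (by omega)).2 hy') h1 h2
  have heq : secHeights w c y₀ = secHeights w (c + 1) y₀ := by
    rw [hS, hS1]
    ext y'
    simp only [Finset.mem_filter]
    constructor
    · rintro ⟨hy', h1, h2⟩
      exact ⟨(htr y' (by omega) h2).1 hy', h1, h2⟩
    · rintro ⟨hy', h1, h2⟩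
      exact ⟨(htr y' (by omega) h2).2 hy', h1, h2⟩
  refine ⟨hl1, ?_, ?_, ?_⟩
  · rw [add_sub_cancel_right]
    exact hl
  · rw [add_sub_cancel_right, heq]
  · rintro j hj ⟨y', hy', hjy'⟩
    rw [← heq, hS, Finset.mem_filter] at hy'
    exact H j (by omega) (by omega)

/-! ### The census of a polygon word -/

/-- `a` is the **bottom row of the run** at the gap `g` through the row `y`: the rows `a … y`
are active and the row `a-1` is not. [folklore] -/
def BotRel (w : List (Fin 4)) (g a y : ℤ) : Prop :=
  a ≤ y ∧ (∀ j, a ≤ j → j ≤ y → ActiveW w g j) ∧ ¬ ActiveW w g (a - 1)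

/-- The sections with at least `2k` horizontal bonds (the `K`-sections, `K ≥ k`). [folklore] -/
def bigSecs (w : List (Fin 4)) (k : ℕ) : Finset (ℤ × ℤ) :=
  (sections w).filter fun s => 2 * k ≤ (secHeights w s.1 s.2).card

open Classical in
/-- The big sections recorded as pairs `(gap, bottom row of the run)`. [folklore] -/
def secPairs (w : List (Fin 4)) (k : ℕ) : Finset (ℤ × ℤ) :=
  (((bigSecs w k).image Prod.fst) ×ˢ rowsW w).filter
    fun p => ∃ y, (p.1, y) ∈ bigSecs w k ∧ BotRel w p.1 p.2 y

/-- **The census of a polygon word**: its rows, extreme bond columns, bonds, and big sections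
by bottom rows. [folklore] -/
abbrev censusW (w : List (Fin 4)) (k : ℕ) : Census :=
  ⟨rowsW w, Lw w, Rw w, bondsW w, secPairs w k⟩

/-- Membership in `secPairs`. [folklore] -/
theorem mem_secPairs {k : ℕ} {p : ℤ × ℤ} :
    p ∈ secPairs w k ↔ ∃ y, (p.1, y) ∈ bigSecs w k ∧ BotRel w p.1 p.2 y := by
  classical
  rw [secPairs, Finset.mem_filter, Finset.mem_product, Finset.mem_image]
  constructor
  · exact fun h => h.2
  · rintro ⟨y, hy, hb⟩
    exact ⟨⟨⟨(p.1, y), hy, rfl⟩, (hb.2.1 p.2 le_rfl hb.1).1⟩, y, hy, hb⟩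

/-- **Section-minimality in census form**: two recorded big sections with the same bottom row at
gaps `c < c'`, all gaps of `[c, c']` having the same run `[a, b-1]`, are separated by a vertical
bond in a column of `(c, c']` and a row of the run — in fact in column `c+1`, for otherwise
`(c+1, y₀)` duplicates the section `(c, y₀)` (`IsCanon.isDup_of_noBond`).
[cite: Rechnitzer2006Haruspicy2, §2.2, Lemma 7 (proof)] -/
theorem censusW_sm (hw : IsCanon w) (hm : IsSecMin w) (k : ℕ) {a b c c' : ℤ}
    (hs : (c, a) ∈ secPairs w k) (hcc' : c < c')
    (hruns : ∀ g, c ≤ g → g ≤ c' → (censusW w k).IsRun g a b) :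
    ∃ p ∈ bondsW w, c < p.1 ∧ p.1 ≤ c' ∧ a ≤ p.2 ∧ p.2 < b := by
  classical
  obtain ⟨y₀, hy₀, hay, hact, -⟩ := mem_secPairs.1 hs
  have hsec : (c, y₀) ∈ sections w := by
    rw [bigSecs, Finset.mem_filter] at hy₀
    exact hy₀.1
  have hl : IsLeader w c y₀ := (mem_sections (p := (c, y₀))).1 hsec
  obtain ⟨hab, hcrun, hcbot, hctop⟩ := hruns c le_rfl hcc'.le
  obtain ⟨-, hc1run, hc1bot, hc1top⟩ := hruns (c + 1) (by omega) (by omega)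
  by_cases hex : ∃ m, a ≤ m ∧ m < b ∧ c + 1 ∈ rowCols w m
  · obtain ⟨m, h1, h2, hmem⟩ := hex
    exact ⟨(c + 1, m), mem_bondsW.2 hmem, by omega, by omega, h1, h2⟩
  · exfalso
    have H : ∀ m, a ≤ m → m < b → c + 1 ∉ rowCols w m := fun m h1 h2 hmem =>
      hex ⟨m, h1, h2, hmem⟩
    have hyb : y₀ < b := by
      by_contra hle
      exact hctop (hact b hab.le (by omega))
    exact hm (c + 1) y₀ (hw.isDup_of_noBond hl hay hyb
      (fun j h1 h2 => ⟨hcrun j h1 h2, hc1run j h1 h2⟩) ⟨hcbot, hc1bot⟩ ⟨hctop, hc1top⟩ H)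

/-- The census of a section-minimal canonical word is valid. [folklore] -/
theorem censusW_valid (hw : IsCanon w) (hm : IsSecMin w) (k : ℕ) : (censusW w k).Valid := by
  refine ⟨fun j hj => ?_, fun j hj => ?_, fun j hj => ?_, fun p hp => ?_, fun s hs => ?_,
    fun a b c c' hs _ hcc' hruns => censusW_sm hw hm k hs hcc' hruns⟩
  · exact hw.1.Lw_lt_Rw (mem_rowsW.1 hj)
  · exact mem_bondsW.2 (Lw_mem (mem_rowsW.1 hj))
  · exact mem_bondsW.2 (Rw_mem (mem_rowsW.1 hj))
  · have hc := mem_bondsW.1 hp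
    exact ⟨mem_rowsW.2 ⟨_, hc⟩, Lw_le hc, le_Rw hc⟩
  · obtain ⟨y, -, hay, hact, hbot⟩ := mem_secPairs.1 hs
    exact ⟨hact s.2 le_rfl hay, hbot⟩

/-! ### Big sections have bottom rows; the census records them faithfully -/

/-- The rows between the least and a larger height of a section are active at its gap. [folklore] -/
theorem activeW_of_mem_secHeights {g y j b : ℤ} (hb : b ∈ secHeights w g y) (hyj : y ≤ j)
    (hjb : j < b) : ActiveW w g j :=
  activeW_iff_not_crosses.2 fun hc => (mem_secHeights.1 hb).2.2 ⟨j, hyj, hjb, hc⟩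

/-- A section with at least two heights has a height above its leader. [folklore] -/
theorem exists_mem_secHeights_gt {g y : ℤ} (h2 : 2 ≤ (secHeights w g y).card) :
    ∃ b ∈ secHeights w g y, y < b := by
  obtain ⟨u, hu, v, hv, huv⟩ := Finset.one_lt_card.1 (by omega : 1 < (secHeights w g y).card)
  have hu' := (mem_secHeights.1 hu).2.1
  have hv' := (mem_secHeights.1 hv).2.1
  rcases lt_or_gt_of_ne huv with h | h
  · exact ⟨v, hv, by omega⟩
  · exact ⟨u, hu, by omega⟩

/-- **Every active row lies over a bottom row** (the rows being finitely many). [folklore] -/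
theorem exists_botRel {g y : ℤ} (hact : ActiveW w g y) : ∃ a, BotRel w g a y := by
  classical
  have hne : (rowsW w).Nonempty := ⟨y, hact.1⟩
  have hex : ∃ n : ℕ, ¬ ActiveW w g (y - 1 - n) := by
    refine ⟨(y - 1 - (rowsW w).min' hne).toNat + 1, fun h => ?_⟩
    have := (rowsW w).min'_le _ h.1
    omega
  refine ⟨y - Nat.find hex, by omega, fun j hj1 hj2 => ?_, ?_⟩
  · rcases eq_or_lt_of_le hj2 with rfl | hlt
    · exact hact
    · obtain ⟨m, rfl⟩ : ∃ m : ℕ, j = y - 1 - m := ⟨(y - 1 - j).toNat, by omega⟩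
      have hm : m < Nat.find hex := by omega
      have := Nat.find_min hex hm
      tauto
  · have := Nat.find_spec hex
    rwa [show y - (Nat.find hex : ℤ) - 1 = y - 1 - Nat.find hex by omega]

/-- **Distinct sections of one gap lie over distinct runs**: two leaders over the same bottom row
coincide (the lower one would not be separated from the upper one). [folklore] -/
theorem botRel_unique {g a y₁ y₂ : ℤ} (hl₁ : IsLeader w g y₁) (hl₂ : IsLeader w g y₂)
    (h₁ : BotRel w g a y₁) (h₂ : BotRel w g a y₂) : y₁ = y₂ := by
  by_contra hne
  rcases lt_or_gt_of_ne hne with hlt | hlt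
  · obtain ⟨j, hj1, hj2, hc⟩ := hl₂.2 y₁ hl₁.1 hlt
    have := h₁.1
    exact activeW_iff_not_crosses.1 (h₂.2.1 j (by omega) (by omega)) hc
  · obtain ⟨j, hj1, hj2, hc⟩ := hl₁.2 y₂ hl₂.1 hlt
    have := h₂.1
    exact activeW_iff_not_crosses.1 (h₁.2.1 j (by omega) (by omega)) hc

/-- **The big sections are at most as many as the recorded pairs** `(gap, bottom row)`.
[folklore] -/
theorem card_bigSecs_le_card_secPairs {k : ℕ} (hk : 1 ≤ k) :
    (bigSecs w k).card ≤ (secPairs w k).card := by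
  classical
  refine Finset.card_le_card_of_forall_subsingleton (fun s p => p.1 = s.1 ∧ BotRel w s.1 p.2 s.2)
    ?_ ?_
  · rintro ⟨g, y⟩ hs
    have hs' := hs
    rw [bigSecs, Finset.mem_filter] at hs'
    have hcard : 2 * k ≤ (secHeights w g y).card := hs'.2
    obtain ⟨b, hb, hyb⟩ := exists_mem_secHeights_gt (w := w) (g := g) (y := y) (by omega)
    obtain ⟨a, ha⟩ := exists_botRel (activeW_of_mem_secHeights hb le_rfl hyb)
    exact ⟨(g, a), mem_secPairs.2 ⟨y, hs, ha⟩, rfl, ha⟩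
  · rintro ⟨g, a⟩ - ⟨g₁, y₁⟩ ⟨hs₁, hg₁, hb₁⟩ ⟨g₂, y₂⟩ ⟨hs₂, hg₂, hb₂⟩
    have hg₁' : g₁ = g := hg₁.symm
    have hg₂' : g₂ = g := hg₂.symm
    have hb₁' : BotRel w g a y₁ := by rw [← hg₁']; exact hb₁
    have hb₂' : BotRel w g a y₂ := by rw [← hg₂']; exact hb₂
    have hs₁' : (g, y₁) ∈ bigSecs w k := by rw [← hg₁']; exact hs₁
    have hs₂' : (g, y₂) ∈ bigSecs w k := by rw [← hg₂']; exact hs₂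
    rw [bigSecs, Finset.mem_filter] at hs₁' hs₂'
    have hl₁ : IsLeader w g y₁ := (mem_sections (p := (g, y₁))).1 hs₁'.1
    have hl₂ : IsLeader w g y₂ := (mem_sections (p := (g, y₂))).1 hs₂'.1
    rw [hg₁', hg₂', botRel_unique hl₁ hl₂ hb₁' hb₂']

/-! ### Rows of even rank carry inner bonds on both sides -/

/-- **Both sides separately** (the printed "any even number"): at a row of even rank of a
section the numbers of vertical letters left and right of the gap are both even and positive,
hence both `≥ 2` (cf. `IsSAP.two_add_le_card_vLeft_add_card_vRight`, which adds them up).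
[cite: Rechnitzer2006Haruspicy2, Lemma 10 (proof)] -/
theorem IsSAP.two_le_card_vLeft_vRight (h : IsSAP w) {g y : ℤ} (hl : IsLeader w g y)
    {j : ℤ} (hyj : y ≤ j) (hjb : ∃ b ∈ secHeights w g y, j < b)
    (he : Even (rankLE (secHeights w g y) j)) :
    2 ≤ (vLeft w g j).card ∧ 2 ≤ (vRight w g j).card := by
  classical
  obtain ⟨b, hb, hjb⟩ := hjb
  have hbY := mem_secHeights.1 hb
  have hncross : ¬ Crosses w g j := fun hc => hbY.2.2 ⟨j, hyj, hjb, hc⟩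
  have hL : 1 ≤ (vLeft w g j).card :=
    Finset.card_pos.2 (vLeft_nonempty_of_not_crossL fun hc => hncross (Or.inl hc))
  have hR : 1 ≤ (vRight w g j).card :=
    Finset.card_pos.2 (vRight_nonempty_of_not_crossR fun hc => hncross (Or.inr hc))
  -- the heights of the gap `≤ j` are those below `y` and those of the section `≤ j`
  set low := (gapHeights w g).filter fun y' => y' < y with hlow
  have hsplit : ((gapHeights w g).filter fun y' => y' ≤ j) =
      low ∪ (secHeights w g y).filter fun y' => y' ≤ j := by
    ext y'
    simp only [hlow, Finset.mem_union, Finset.mem_filter, mem_secHeights]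
    constructor
    · rintro ⟨hy', hle⟩
      by_cases hlt : y' < y
      · exact Or.inl ⟨hy', hlt⟩
      · refine Or.inr ⟨⟨hy', not_lt.1 hlt, ?_⟩, hle⟩
        rintro ⟨j', h1, h2, h3⟩
        exact hbY.2.2 ⟨j', h1, by omega, h3⟩
    · rintro (⟨hy', hlt⟩ | ⟨⟨hy', -, -⟩, hle⟩)
      · exact ⟨hy', by omega⟩
      · exact ⟨hy', hle⟩
  have hdisj : Disjoint low ((secHeights w g y).filter fun y' => y' ≤ j) := by
    rw [Finset.disjoint_left]
    intro y' h1 h2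
    rw [hlow, Finset.mem_filter] at h1
    rw [Finset.mem_filter, mem_secHeights] at h2
    omega
  have hcount : (hBelow w g j).card = low.card + rankLE (secHeights w g y) j := by
    rw [h.card_hBelow, hsplit, Finset.card_union_of_disjoint hdisj, rankLE]
  -- the heights below `y` are even in number: they end at a crossing section line
  have hlow_even : Even low.card := by
    rcases low.eq_empty_or_nonempty with he | hne
    · rw [he]; exact ⟨0, rfl⟩
    set y₀ := low.max' hne
    have hy₀ : y₀ ∈ low := Finset.max'_mem _ _
    rw [hlow, Finset.mem_filter] at hy₀
    obtain ⟨j₀, h1, h2, hcross⟩ := hl.2 y₀ hy₀.1 hy₀.2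
    have hcount₀ : (hBelow w g j₀).card = low.card := by
      rw [h.card_hBelow]
      congr 1
      ext y'
      simp only [Finset.mem_filter, hlow]
      constructor
      · rintro ⟨hy', hle⟩; exact ⟨hy', by omega⟩
      · rintro ⟨hy', hlt⟩
        have : y' ≤ y₀ := Finset.le_max' low y' (by rw [hlow, Finset.mem_filter]; exact ⟨hy', hlt⟩)
        exact ⟨hy', this.trans h1⟩
    rcases hcross with hc | hc
    · have := even_card_hBelow_add_card_vLeft h.2.1 g j₀
      rwa [vLeft_eq_empty_of_crossL hc, Finset.card_empty, add_zero, hcount₀] at this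
    · have := even_card_hBelow_add_card_vRight h.2.1 g j₀
      rwa [vRight_eq_empty_of_crossR hc, Finset.card_empty, add_zero, hcount₀] at this
  -- parities of the two sides
  have hpL := even_card_hBelow_add_card_vLeft h.2.1 g j
  have hpR := even_card_hBelow_add_card_vRight h.2.1 g j
  rw [hcount] at hpL hpR
  obtain ⟨c₀, hc₀⟩ := hlow_even
  obtain ⟨r, hr⟩ := he
  rw [Nat.even_iff] at hpL hpR
  constructor <;> omega

/-- Two vertical letters left of the gap give an inner bond column `Lw j < col ≤ g`. [folklore] -/
theorem IsSAP.exists_inner_left (h : IsSAP w) {g j : ℤ} (h2 : 2 ≤ (vLeft w g j).card) :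
    ∃ col ∈ rowCols w j, Lw w j < col ∧ col ≤ g := by
  classical
  obtain ⟨i₁, h₁, i₂, h₂, hne⟩ := Finset.one_lt_card.1 (by omega : 1 < (vLeft w g j).card)
  simp only [vLeft, Finset.mem_filter, Finset.mem_range] at h₁ h₂
  have hcol : vtx w i₁ 0 ≠ vtx w i₂ 0 := fun heq =>
    hne (h.eq_of_row_eq h₁.1 h₂.1 h₁.2.1 h₂.2.1 heq (h₁.2.2.1.trans h₂.2.2.1.symm))
  have hm₁ : vtx w i₁ 0 ∈ rowCols w j := mem_rowCols.2 ⟨i₁, h₁.1, h₁.2.1, h₁.2.2.1, rfl⟩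
  have hm₂ : vtx w i₂ 0 ∈ rowCols w j := mem_rowCols.2 ⟨i₂, h₂.1, h₂.2.1, h₂.2.2.1, rfl⟩
  have a₁ := Lw_le hm₁
  have a₂ := Lw_le hm₂
  rcases lt_or_gt_of_ne hcol with hlt | hlt
  · exact ⟨_, hm₂, by omega, h₂.2.2.2⟩
  · exact ⟨_, hm₁, by omega, h₁.2.2.2⟩

/-- Two vertical letters right of the gap give an inner bond column `g < col < Rw j`. [folklore] -/
theorem IsSAP.exists_inner_right (h : IsSAP w) {g j : ℤ} (h2 : 2 ≤ (vRight w g j).card) :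
    ∃ col ∈ rowCols w j, g < col ∧ col < Rw w j := by
  classical
  obtain ⟨i₁, h₁, i₂, h₂, hne⟩ := Finset.one_lt_card.1 (by omega : 1 < (vRight w g j).card)
  simp only [vRight, Finset.mem_filter, Finset.mem_range] at h₁ h₂
  have hcol : vtx w i₁ 0 ≠ vtx w i₂ 0 := fun heq =>
    hne (h.eq_of_row_eq h₁.1 h₂.1 h₁.2.1 h₂.2.1 heq (h₁.2.2.1.trans h₂.2.2.1.symm))
  have hm₁ : vtx w i₁ 0 ∈ rowCols w j := mem_rowCols.2 ⟨i₁, h₁.1, h₁.2.1, h₁.2.2.1, rfl⟩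
  have hm₂ : vtx w i₂ 0 ∈ rowCols w j := mem_rowCols.2 ⟨i₂, h₂.1, h₂.2.1, h₂.2.2.1, rfl⟩
  have b₁ := le_Rw hm₁
  have b₂ := le_Rw hm₂
  rcases lt_or_gt_of_ne hcol with hlt | hlt
  · exact ⟨_, hm₁, by omega, by omega⟩
  · exact ⟨_, hm₂, by omega, by omega⟩

/-! ### At least `6k-5` unused bonds -/

open Classical in
/-- **The unused bonds number at least `6k-5`** when the outermost big sections lie at the gaps
`gL ≤ gR`: `k-1` inner bonds left of `gL` and `k-1` right of `gR` (rows of even rank of the two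
sections, as in Lemma 10), `2k-2` leftmost bonds of inner rows of the left section, `2k-2`
rightmost bonds of inner rows of the right section, and the rightmost bond of the lowest row.
(This replaces the stretching of Lemma 11: these are bonds to which no section between `gL` and
`gR` is charged.) [cite: Rechnitzer2006Haruspicy2, Lemmas 10–11 and Theorem 12 (proof)] -/
theorem card_unused_ge (hw : IsCanon w) {k : ℕ} (hk : 1 ≤ k) {gL gR yL yR : ℤ} (hLR : gL ≤ gR)
    (hsL : (gL, yL) ∈ bigSecs w k) (hsR : (gR, yR) ∈ bigSecs w k) :
    6 * k - 5 ≤ ((bondsW w).filter fun p => (censusW w k).Unused gL gR p).card := by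
  obtain ⟨U, hU⟩ : ∃ U, U = (bondsW w).filter fun p => (censusW w k).Unused gL gR p := ⟨_, rfl⟩
  rw [← hU]
  have hmemU : ∀ p, p ∈ U ↔ p ∈ bondsW w ∧ (censusW w k).Unused gL gR p := fun p => by
    rw [hU, Finset.mem_filter]
  rw [bigSecs, Finset.mem_filter] at hsL hsR
  obtain ⟨hsecL, hcardL⟩ := hsL
  obtain ⟨hsecR, hcardR⟩ := hsR
  have hlL : IsLeader w gL yL := (mem_sections (p := (gL, yL))).1 hsecL
  have hlR : IsLeader w gR yR := (mem_sections (p := (gR, yR))).1 hsecR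
  set SL := secHeights w gL yL with hSL
  set SR := secHeights w gR yR with hSR
  have hyL : yL ∈ SL := hlL.mem_secHeights
  have hyR : yR ∈ SR := hlR.mem_secHeights
  have hneL : SL.Nonempty := ⟨yL, hyL⟩
  have hneR : SR.Nonempty := ⟨yR, hyR⟩
  have hminL : SL.min' hneL = yL :=
    le_antisymm (Finset.min'_le _ _ hyL)
      (Finset.le_min' _ _ _ fun y' hy' => (mem_secHeights.1 hy').2.1)
  have hminR : SR.min' hneR = yR :=
    le_antisymm (Finset.min'_le _ _ hyR)
      (Finset.le_min' _ _ _ fun y' hy' => (mem_secHeights.1 hy').2.1)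
  obtain ⟨tL, htL⟩ : ∃ t, t = SL.max' hneL := ⟨_, rfl⟩
  obtain ⟨tR, htR⟩ : ∃ t, t = SR.max' hneR := ⟨_, rfl⟩
  have htLmem : tL ∈ SL := by rw [htL]; exact Finset.max'_mem _ _
  have htRmem : tR ∈ SR := by rw [htR]; exact Finset.max'_mem _ _
  -- the sections span at least `2k` rows
  have hsubL : SL ⊆ Finset.Icc yL tL := fun y' hy' =>
    Finset.mem_Icc.2 ⟨(mem_secHeights.1 hy').2.1, by rw [htL]; exact Finset.le_max' _ _ hy'⟩
  have hsubR : SR ⊆ Finset.Icc yR tR := fun y' hy' =>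
    Finset.mem_Icc.2 ⟨(mem_secHeights.1 hy').2.1, by rw [htR]; exact Finset.le_max' _ _ hy'⟩
  have hcL := Finset.card_le_card hsubL
  have hcR := Finset.card_le_card hsubR
  rw [Int.card_Icc] at hcL hcR
  -- the rows of the two sections are active at their gaps
  have hactL : ∀ m, yL ≤ m → m < tL → ActiveW w gL m := fun m h1 h2 =>
    activeW_of_mem_secHeights htLmem h1 h2
  have hactR : ∀ m, yR ≤ m → m < tR → ActiveW w gR m := fun m h1 h2 =>
    activeW_of_mem_secHeights htRmem h1 h2
  have hrows : (rowsW w).Nonempty := ⟨yL, (hactL yL le_rfl (by omega)).1⟩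
  -- the five families of unused bonds
  obtain ⟨U1L, hU1L⟩ : ∃ s, s = U.filter fun p => Lw w p.2 < p.1 ∧ p.1 < Rw w p.2 ∧ p.1 ≤ gL :=
    ⟨_, rfl⟩
  obtain ⟨U1R, hU1R⟩ : ∃ s, s = U.filter fun p => Lw w p.2 < p.1 ∧ p.1 < Rw w p.2 ∧ gR < p.1 :=
    ⟨_, rfl⟩
  obtain ⟨U2, hU2⟩ : ∃ s, s = (Finset.Ioo yL tL).image fun m => (Lw w m, m) := ⟨_, rfl⟩
  obtain ⟨U3, hU3⟩ : ∃ s, s = (Finset.Ioo yR tR).image fun m => (Rw w m, m) := ⟨_, rfl⟩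
  obtain ⟨m₀, hm₀⟩ : ∃ m, m = (rowsW w).min' hrows := ⟨_, rfl⟩
  obtain ⟨U4, hU4⟩ : ∃ s : Finset (ℤ × ℤ), s = {(Rw w m₀, m₀)} := ⟨_, rfl⟩
  have hm₀mem : m₀ ∈ rowsW w := by rw [hm₀]; exact Finset.min'_mem _ _
  have hm₀1 : m₀ - 1 ∉ rowsW w := fun h => by
    have := (rowsW w).min'_le _ h
    omega
  have hmem1L : ∀ p, p ∈ U1L ↔ p ∈ U ∧ Lw w p.2 < p.1 ∧ p.1 < Rw w p.2 ∧ p.1 ≤ gL := fun p => by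
    rw [hU1L, Finset.mem_filter]
  have hmem1R : ∀ p, p ∈ U1R ↔ p ∈ U ∧ Lw w p.2 < p.1 ∧ p.1 < Rw w p.2 ∧ gR < p.1 := fun p => by
    rw [hU1R, Finset.mem_filter]
  have hmem2 : ∀ p, p ∈ U2 ↔ ∃ m, (yL < m ∧ m < tL) ∧ (Lw w m, m) = p := fun p => by
    rw [hU2, Finset.mem_image]
    simp only [Finset.mem_Ioo]
  have hmem3 : ∀ p, p ∈ U3 ↔ ∃ m, (yR < m ∧ m < tR) ∧ (Rw w m, m) = p := fun p => by
    rw [hU3, Finset.mem_image]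
    simp only [Finset.mem_Ioo]
  have hmem4 : ∀ p, p ∈ U4 ↔ p = (Rw w m₀, m₀) := fun p => by
    rw [hU4, Finset.mem_singleton]
  -- they consist of unused bonds
  have hU1Lsub : U1L ⊆ U := fun p hp => ((hmem1L p).1 hp).1
  have hU1Rsub : U1R ⊆ U := fun p hp => ((hmem1R p).1 hp).1
  have hU2sub : U2 ⊆ U := by
    intro p hp
    obtain ⟨m, hm, rfl⟩ := (hmem2 p).1 hp
    have ha := hactL m (by omega) hm.2
    have ha1 := hactL (m - 1) (by omega) (by omega)
    exact (hmemU _).2 ⟨mem_bondsW.2 (Lw_mem (mem_rowsW.1 ha.1)), Or.inr (Or.inl ⟨rfl, ha, ha1⟩)⟩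
  have hU3sub : U3 ⊆ U := by
    intro p hp
    obtain ⟨m, hm, rfl⟩ := (hmem3 p).1 hp
    have ha := hactR m (by omega) hm.2
    have ha1 := hactR (m - 1) (by omega) (by omega)
    exact (hmemU _).2 ⟨mem_bondsW.2 (Rw_mem (mem_rowsW.1 ha.1)),
      Or.inr (Or.inr (Or.inl ⟨rfl, ha, ha1⟩))⟩
  have hU4sub : U4 ⊆ U := by
    intro p hp
    rw [(hmem4 p).1 hp]
    exact (hmemU _).2 ⟨mem_bondsW.2 (Rw_mem (mem_rowsW.1 hm₀mem)),
      Or.inr (Or.inr (Or.inr ⟨rfl, hm₀1⟩))⟩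
  -- the inner bonds of the rows of even rank
  have h1L : ((Finset.Ico yL tL).filter fun j => Even (rankLE SL j)).card ≤ U1L.card := by
    refine Finset.card_le_card_of_forall_subsingleton (fun j p => p.2 = j) ?_ ?_
    · intro j hj
      rw [Finset.mem_filter, Finset.mem_Ico] at hj
      obtain ⟨⟨hj1, hj2⟩, hev⟩ := hj
      have hact := hactL j hj1 hj2
      obtain ⟨h2, -⟩ := hw.1.two_le_card_vLeft_vRight hlL hj1 ⟨tL, htLmem, hj2⟩ hev
      obtain ⟨col, hcol, hLc, hcg⟩ := hw.1.exists_inner_left h2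
      have hcR : col < Rw w j := lt_of_le_of_lt hcg hact.2.2
      refine ⟨(col, j), ?_, rfl⟩
      exact (hmem1L _).2 ⟨(hmemU _).2 ⟨mem_bondsW.2 hcol, Or.inl ⟨hLc, hcR, Or.inl hcg⟩⟩,
        hLc, hcR, hcg⟩
    · rintro p - j₁ ⟨-, h₁⟩ j₂ ⟨-, h₂⟩
      exact h₁.symm.trans h₂
  have h1R : ((Finset.Ico yR tR).filter fun j => Even (rankLE SR j)).card ≤ U1R.card := by
    refine Finset.card_le_card_of_forall_subsingleton (fun j p => p.2 = j) ?_ ?_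
    · intro j hj
      rw [Finset.mem_filter, Finset.mem_Ico] at hj
      obtain ⟨⟨hj1, hj2⟩, hev⟩ := hj
      have hact := hactR j hj1 hj2
      obtain ⟨-, h2⟩ := hw.1.two_le_card_vLeft_vRight hlR hj1 ⟨tR, htRmem, hj2⟩ hev
      obtain ⟨col, hcol, hcg, hcR⟩ := hw.1.exists_inner_right h2
      have hLc : Lw w j < col := lt_of_le_of_lt hact.2.1 hcg
      refine ⟨(col, j), ?_, rfl⟩
      exact (hmem1R _).2 ⟨(hmemU _).2 ⟨mem_bondsW.2 hcol, Or.inl ⟨hLc, hcR, Or.inr hcg⟩⟩,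
        hLc, hcR, hcg⟩
    · rintro p - j₁ ⟨-, h₁⟩ j₂ ⟨-, h₂⟩
      exact h₁.symm.trans h₂
  have hEL := card_filter_even_rankLE SL hneL
  have hER := card_filter_even_rankLE SR hneR
  rw [hminL, ← htL] at hEL
  rw [hminR, ← htR] at hER
  -- pairwise disjointness
  have hd1 : Disjoint U1L U1R := Finset.disjoint_left.2 fun p h1 h2 => by
    have g1 := (hmem1L p).1 h1
    have g2 := (hmem1R p).1 h2
    omega
  have hd2 : Disjoint (U1L ∪ U1R) U2 := Finset.disjoint_left.2 fun p h1 h2 => by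
    obtain ⟨m, -, rfl⟩ := (hmem2 p).1 h2
    rcases Finset.mem_union.1 h1 with h | h
    · exact lt_irrefl _ ((hmem1L _).1 h).2.1
    · exact lt_irrefl _ ((hmem1R _).1 h).2.1
  have hd3 : Disjoint (U1L ∪ U1R ∪ U2) U3 := Finset.disjoint_left.2 fun p h1 h2 => by
    obtain ⟨m, hm, rfl⟩ := (hmem3 p).1 h2
    have ha := hactR m (by omega) hm.2
    have hlt := hw.1.Lw_lt_Rw (mem_rowsW.1 ha.1)
    rcases Finset.mem_union.1 h1 with h | h
    · rcases Finset.mem_union.1 h with h' | h'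
      · exact lt_irrefl _ ((hmem1L _).1 h').2.2.1
      · exact lt_irrefl _ ((hmem1R _).1 h').2.2.1
    · obtain ⟨m', -, hm'⟩ := (hmem2 _).1 h
      have h2' := congrArg Prod.snd hm'
      have h1' := congrArg Prod.fst hm'
      simp only at h1' h2'
      rw [h2'] at h1'
      omega
  have hd4 : Disjoint (U1L ∪ U1R ∪ U2 ∪ U3) U4 := Finset.disjoint_left.2 fun p h1 h2 => by
    rw [(hmem4 p).1 h2] at h1
    have hlt := hw.1.Lw_lt_Rw (mem_rowsW.1 hm₀mem)
    rcases Finset.mem_union.1 h1 with h | h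
    · rcases Finset.mem_union.1 h with h' | h'
      · rcases Finset.mem_union.1 h' with h'' | h''
        · exact lt_irrefl _ ((hmem1L _).1 h'').2.2.1
        · exact lt_irrefl _ ((hmem1R _).1 h'').2.2.1
      · obtain ⟨m', -, hm'⟩ := (hmem2 _).1 h'
        have h2' := congrArg Prod.snd hm'
        have h1' := congrArg Prod.fst hm'
        simp only at h1' h2'
        rw [h2'] at h1'
        omega
    · obtain ⟨m', hm', hmm'⟩ := (hmem3 _).1 h
      have h2' : m' = m₀ := congrArg Prod.snd hmm'
      have ha1 := hactR (m' - 1) (by omega) (by omega)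
      rw [h2'] at ha1
      exact hm₀1 ha1.1
  -- adding up
  have hsub : U1L ∪ U1R ∪ U2 ∪ U3 ∪ U4 ⊆ U :=
    Finset.union_subset (Finset.union_subset (Finset.union_subset (Finset.union_subset
      hU1Lsub hU1Rsub) hU2sub) hU3sub) hU4sub
  have hcard := Finset.card_le_card hsub
  rw [Finset.card_union_of_disjoint hd4, Finset.card_union_of_disjoint hd3,
    Finset.card_union_of_disjoint hd2, Finset.card_union_of_disjoint hd1] at hcard
  have c2 : U2.card = (Finset.Ioo yL tL).card := by
    rw [hU2]
    exact Finset.card_image_of_injective _ fun m m' h => by simpa using congrArg Prod.snd h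
  have c3 : U3.card = (Finset.Ioo yR tR).card := by
    rw [hU3]
    exact Finset.card_image_of_injective _ fun m m' h => by simpa using congrArg Prod.snd h
  rw [Int.card_Ioo] at c2 c3
  have c4 : U4.card = 1 := by
    rw [hU4]
    exact Finset.card_singleton _
  omega

/-! ### Theorem 12 -/

/-- **Rechnitzer 2006, Theorem 12, PROVED** (discharge of `Rechnitzer2006_thm12`): a
section-minimal canonical word with `6k-4+2M` vertical letters has at most `2M+1` sections with
`2k` or more horizontal bonds. Proof: record each such section by (gap, bottom row of its run);
between the outermost two of their gaps the census inequality (`Census.card_secs_le_card`, with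
section-minimality entering through `IsCanon.isDup_of_noBond`) bounds their number by the number
of bonds minus the unused ones, which are at least `6k-5` (`card_unused_ge`); and the bonds are at
most `vcount w = 6k-4+2M`. [cite: Rechnitzer2006Haruspicy2, Theorem 12] -/
theorem Rechnitzer2006_thm12_holds' (hw : IsCanon w) (hm : IsSecMin w) {k M : ℕ} (hk : 1 ≤ k)
    (hv : vcount w = 6 * k - 4 + 2 * M) : (bigSecs w k).card ≤ 2 * M + 1 := by
  classical
  rcases (bigSecs w k).eq_empty_or_nonempty with h0 | hne
  · rw [h0, Finset.card_empty]
    omega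
  set G := (bigSecs w k).image Prod.fst with hG
  have hGne : G.Nonempty := hne.image _
  obtain ⟨sL, hsL, hgL⟩ := Finset.mem_image.1 (Finset.min'_mem G hGne)
  obtain ⟨sR, hsR, hgR⟩ := Finset.mem_image.1 (Finset.max'_mem G hGne)
  have hLR : G.min' hGne ≤ G.max' hGne := Finset.min'_le _ _ (Finset.max'_mem G hGne)
  have hsL' : (G.min' hGne, sL.2) ∈ bigSecs w k := by rw [← hgL]; exact hsL
  have hsR' : (G.max' hGne, sR.2) ∈ bigSecs w k := by rw [← hgR]; exact hsR
  have hval := censusW_valid hw hm k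
  have hGs : ∀ s ∈ (censusW w k).secs, G.min' hGne ≤ s.1 ∧ s.1 ≤ G.max' hGne := by
    intro s hs
    obtain ⟨y, hy, -⟩ := mem_secPairs.1 hs
    have : s.1 ∈ G := Finset.mem_image.2 ⟨(s.1, y), hy, rfl⟩
    exact ⟨Finset.min'_le _ _ this, Finset.le_max' _ _ this⟩
  have h1 := card_bigSecs_le_card_secPairs (w := w) hk
  have h2 := Census.card_secs_le_card hval hGs
  have h3 := Finset.card_filter_add_card_filter_not (s := bondsW w)
    (fun p => (censusW w k).Unused (G.min' hGne) (G.max' hGne) p)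
  have h4 := card_unused_ge hw hk hLR hsL' hsR'
  have h5 := card_bondsW_le w
  change (secPairs w k).card ≤
    ((bondsW w).filter fun p => ¬ (censusW w k).Unused (G.min' hGne) (G.max' hGne) p).card at h2
  omega

end Haruspicy

open Haruspicy in
/-- **Rechnitzer 2006, Theorem 12** (discharge of the named fact `Rechnitzer2006_thm12`): "A
section-minimal polygon `P` that contains `2V = (6k-4+2M)` vertical bonds may not contain more
than `2M+1` sections that contain `2k` or more horizontal bonds."
[cite: Rechnitzer2006Haruspicy2, Theorem 12] -/
theorem Rechnitzer2006_thm12_holds : Rechnitzer2006_thm12 := by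
  intro w hw hm k M hk hv
  exact Rechnitzer2006_thm12_holds' hw hm hk hv

end Literature.Barriers.CriticalPhenomena
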